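import Mathlib
import Literature.NumberTheory.DiophantineApproximation.SimultaneousApproxComplexity
import Literature.Computability.Complexity.KnapsackPartition
import Literature.Computability.Complexity.OneInThreeSubsetSumMachine
import Literature.Computability.Complexity.CodeFPRat
import Literature.Computability.Complexity.CodeFPArith
import Literature.Computability.Complexity.CodeFPStrings
import HarnessLib

/-!
# GOOD SIMULTANEOUS APPROXIMATION is NP-complete (Lagarias 1985): the discharge

Topic `NumberTheory/DiophantineApproximation`; sibling proof file of `SimultaneousApproxComplexity.lean`,
discharging its named fact `Lagarias1985_gsa_isNPComplete : IsNPComplete gsaLang`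
(**`Lagarias1985_gsa_isNPComplete_holds`**, last declaration of this file) at the machine level of the
tree (`IsNPComplete` = `∈ NP` for `NP = polyExists P` and Karp-hardness `IsNPHard`, languages over `{0,1}`,
polynomial time = Mathlib's `TM2ComputableInPolyTime` through the tree's `FP`).

Lagarias (SIAM J. Comput. 14 (1985); Nemhauser–Wolsey 1988, notes to §I.7.5: "Lagarias (1985) has shown
that the simultaneous diophantine approximation problem is NP-complete"; statement transcribed in the
statement file from Schrijver 1986, p. 168) proves: GSA — given `α = a/b ∈ ℚ^d`, `N` and `ε`, is there
`1 ≤ q ≤ N` with `‖q αᵢ‖ ≤ ε` for all `i` — is NP-complete, membership by the certificate `q`, hardness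
by a transformation from van Emde Boas's WEAK PARTITION (`∃ x ∈ {-1,0,1}ⁿ ∖ {0}, Σ xᵢ aᵢ = 0`,
NP-complete by van Emde Boas 1981, Thm. 1), the residues of `q` modulo pairwise coprime moduli carrying
the digits `xᵢ`.

## What is proved here, and the one deviation from the printed route

* `Lagarias.gsaLang_mem_NP` — **GSA ∈ NP**: the certificate is `q` in binary (`|bin q| ≤ |bin N| ≤ |x|`);
  the verifier `Lagarias.verFn` tests that `x` is a GSA code (canonical re-encoding `Lagarias.canonGFn`
  of the tree's code `intVecEncoding.pairBool (ℕ.pairBool (ℕ.pairBool encodingRatBool))` — with the new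
  canonicalisers `Lagarias.canonRatFn` for LOWEST-TERMS rational codes (component canonicalisation, then
  the tree's exact normalisation `CodeFP.ratOfIntNat`) and `Lagarias.canonIVFn` for the dimension-headed
  integer vectors) and then evaluates `1 ≤ q ≤ N ∧ ∀ i, ‖q aᵢ/b‖ ≤ ε` EXACTLY in integers
  (`Lagarias.distOK`: `‖X/b‖ = min(r, b-r)/b`, `r = X mod b`, `Lagarias.distNearestInt_intCast_div_natCast`;
  cross-multiplied against `ε = num/den`), assembled in the typed `CodeFP` algebra (`Lagarias.codeFP_chk`).
* `Lagarias.PARTITION_karpReducible_gsaLang` — **`PARTITION ≤ₚ GSA`**, whence `Lagarias.gsaLang_isNPHard`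
  from `isNPComplete_PARTITION_holds` (Karp 1972, problem 20; in the tree via Cook–Levin, `SAT ≤ₚ 3SAT ≤ₚ
  ONE-IN-THREE 3SAT ≤ₚ KNAPSACK ≤ₚ PARTITION`). DEVIATION (a shorter road inside the tree, which holds
  PARTITION but not WEAK PARTITION): the source problem is PARTITION, and the transformation is the
  composite of
  - LEVEL 1 (`Lagarias.gadget`, PARTITION → weak partition): `w ↦ z :: (items ++ slacks)` in base
    `D = Σw + 5`: `z = Σ_k D^{k+1}`, `item_k = w_k + D^{k+1}`, `slack_k = 2 D^{k+1}`; a balanced nonzero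
    `x` with `Σ xᵢ aᵢ = 0` has vanishing digit columns (`Lagarias.digits_eq_zero`), so `x_z + x_{item k} +
    2 x_{slack k} = 0` for all `k` and `Σ_k x_{item k} w_k = 0`; `x_z = 0` forces `x = 0`, so `x_z = ±1` and
    every `x_{item k}` is odd, i.e. a SIGN, and the signs split `w` evenly (`Lagarias.hasWeakSol_gadget_iff`);
  - LEVEL 2 (`Lagarias.toInstance`, weak partition → GSA, a POSITIONAL variant of Lagarias's residue
    encoding: digits of `q` in one large even base `B = 4(mA+1)` instead of residues modulo coprime
    moduli): `d = m + 1`, `b = B^{m+1}`, `α_{j+1} = 1/B^{j+1}` (numerators `B^{m-j}`), `α₀ = 2y/B^{m+1}` with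
    `y = Σ_j a_j B^{m-j}`, `N = Σ_{k<m} B^k`, `ε = 1/(B-1)`. The digit coordinates force
    `q = Σ_k x_k B^k` with balanced digits `x_k ∈ {-1,0,1}` (`Lagarias.digit_abs_le_one`,
    `Lagarias.top_eq_zero`), and then `q·2y ≡ (cB + 2L) B^m + 2T (mod B^{m+1})` with `L = Σ x_k a_k`,
    `|T| ≤ m A B^{m-1}`: the coordinate `α₀` passes iff `L = 0` (`Lagarias.eqCoord_iff`: `cB + 2L` is
    even and, for `L ≠ 0`, nonzero, hence `≥ 2` in absolute value). Correctness:
    `Lagarias.exists_intSys_iff`, `Lagarias.yes_toInstance_iff`, `Lagarias.partition_iff_yes`.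
  The transformation is computed on codes in the typed `CodeFP` algebra (`Lagarias.codeFP_reduction`:
  lists, `range`, maps with context, powers with unary exponents, sums, `ratOfIntNat` for `ε`), guarded by
  the tree's PARTITION code test `Knapsack.isCanonLFn` (`Lagarias.redFn`).
* `Lagarias.gsa_isNPComplete`, `Lagarias1985_gsa_isNPComplete_holds` — the assembly.

Design notes. (1) Weak-partition vectors are `x : ℕ → ℤ` read on `range m` (`Lagarias.IsWeakSol`), lists
are read by `List.getD · 0`, and all sums are `Finset.range` sums; (2) in the `CodeFP` assembly every
combinator term is closed by `.congr fun _ => rfl` (elaborating a bare `X.comp (…)` against the expected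
map is slow); (3) junk: `b = 0` in a GSA code makes `q aᵢ / b = 0` (Lean's `x / 0 = 0`), and the verifier's
integer test follows this convention (`Lagarias.distOK`), as the statement file documents.

## References

* [Lagarias1985] J. C. Lagarias, *The computational complexity of simultaneous Diophantine approximation
  problems*, SIAM J. Comput. 14 (1985) 196–209, main theorem (GSA is NP-complete). Source not held
  (acquisition requested); statement as vendored in `SimultaneousApproxComplexity.lean` from
  [Schrijver1986], §6.3 p. 168, and confirmed by Nemhauser–Wolsey, *Integer and Combinatorial
  Optimization* (1988), notes to §I.7.5.
* [vanEmdeBoas1981] P. van Emde Boas, *Another NP-complete partition problem and the complexity of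
  computing short vectors in a lattice*, Report 81-04, Amsterdam 1981, Thm. 1 (WEAK PARTITION).
* [Karp1972] R. M. Karp, *Reducibility among combinatorial problems* (1972), Main Theorem, problem 20.
* [AroraBarak2009] S. Arora, B. Barak, *Computational Complexity* (2009), §0.1 (codes), §1.3 (closure of
  polynomial time under composition and bounded loops), Def. 2.1, Def. 2.7.

## NOT here

* Lagarias's fixed-dimension algorithm (`Lagarias1985_gsaOfDim_mem_P`, Lenstra's integer programming) —
  a separate named fact of the statement file.
* WEAK PARTITION as a language of the tree and van Emde Boas's own transformation: the gadget of level 1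
  is used inline only (no new named fact, D-0026).
-/

open Finset

namespace Literature.NumberTheory.DiophantineApproximation

namespace Lagarias

/-! ### Balanced digits -/

/-- **Balanced digits**: if `∑_{e<E} s_e D^e = 0` with all `|s_e| < D` then every `s_e = 0`. [folklore] -/
theorem digits_eq_zero {D : ℤ} (hD : 0 < D) :
    ∀ (E : ℕ) (s : ℕ → ℤ), (∀ e < E, |s e| < D) → ∑ e ∈ range E, s e * D ^ e = 0 → ∀ e < E, s e = 0
  | 0, _, _, _ => fun e he => absurd he (Nat.not_lt_zero e)
  | E + 1, s, hs, h0 => by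
      rw [Finset.sum_range_succ'] at h0
      have hsplit : ∑ e ∈ range E, s (e + 1) * D ^ (e + 1) = D * ∑ e ∈ range E, s (e + 1) * D ^ e := by
        rw [Finset.mul_sum]
        exact sum_congr rfl fun e _ => by ring
      rw [hsplit, pow_zero, mul_one] at h0
      have hdvd : D ∣ s 0 := ⟨-(∑ e ∈ range E, s (e + 1) * D ^ e), by linarith⟩
      have hs0 : s 0 = 0 := Int.eq_zero_of_abs_lt_dvd hdvd (hs 0 (Nat.succ_pos E))
      have hrest : ∑ e ∈ range E, s (e + 1) * D ^ e = 0 := by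
        rw [hs0, add_zero] at h0
        exact (mul_eq_zero.1 h0).resolve_left hD.ne'
      have ih := digits_eq_zero hD E (fun e => s (e + 1)) (fun e he => hs (e + 1) (by omega)) hrest
      intro e he
      cases e with
      | zero => exact hs0
      | succ e => exact ih e (by omega)

/-- Contrapositive use: a nonzero balanced-digit vector has a nonzero value. [folklore] -/
theorem sum_digits_ne_zero {D : ℤ} (hD : 0 < D) {E : ℕ} {s : ℕ → ℤ} (hs : ∀ e < E, |s e| < D)
    {e₀ : ℕ} (he₀ : e₀ < E) (hne : s e₀ ≠ 0) : ∑ e ∈ range E, s e * D ^ e ≠ 0 :=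
  fun h => hne (digits_eq_zero hD E s hs h e₀ he₀)

/-! ### Level 2: the positional encoding (weak partition → GSA), over `av : ℕ → ℕ` of length `m` -/

section LevelTwo

variable (m : ℕ) (av : ℕ → ℕ) (B : ℕ)

/-- `y = ∑_{j<m} a_j B^{m-j}`. [folklore] -/
def yv : ℤ := ∑ j ∈ range m, (av j : ℤ) * (B : ℤ) ^ (m - j)

/-- `N = ∑_{k<m} B^k`. [folklore] -/
def Nv : ℕ := ∑ k ∈ range m, B ^ k

/-- `A = ∑_{j<m} a_j`. [folklore] -/
def Av : ℕ := ∑ j ∈ range m, av j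

/-- upper part `u_k = ∑_{j<k} a_j B^{k-1-j}`. [folklore] -/
def uu (k : ℕ) : ℤ := ∑ j ∈ range k, (av j : ℤ) * (B : ℤ) ^ (k - 1 - j)

/-- lower part `t_k = ∑_{k<j<m} a_j B^{m+k-j}`. [folklore] -/
def tt (k : ℕ) : ℤ := ∑ j ∈ Ico (k + 1) m, (av j : ℤ) * (B : ℤ) ^ (m + k - j)

variable {m av B}

/-- `N (B - 1) = B^m - 1` (geometric sum). [folklore] -/
theorem Nv_mul (m B : ℕ) : (Nv m B : ℤ) * ((B : ℤ) - 1) = (B : ℤ) ^ m - 1 := by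
  unfold Nv
  push_cast
  exact geom_sum_mul (B : ℤ) m

/-- Splitting `B^k · y` at the diagonal. [folklore] -/
theorem pow_mul_yv {k : ℕ} (hk : k < m) :
    (B : ℤ) ^ k * yv m av B = (B : ℤ) ^ (m + 1) * uu av B k + (av k : ℤ) * (B : ℤ) ^ m + tt m av B k := by
  unfold yv uu tt
  have hsplit : ∑ j ∈ range m, (av j : ℤ) * (B : ℤ) ^ (m - j) =
      ∑ j ∈ range k, (av j : ℤ) * (B : ℤ) ^ (m - j) +
        ((av k : ℤ) * (B : ℤ) ^ (m - k) + ∑ j ∈ Ico (k + 1) m, (av j : ℤ) * (B : ℤ) ^ (m - j)) := by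
    rw [Finset.range_eq_Ico, Finset.range_eq_Ico, ← Finset.sum_Ico_consecutive _ (Nat.zero_le k) hk.le,
      Finset.sum_eq_sum_Ico_succ_bot hk]
  have h1 : (B : ℤ) ^ k * ∑ j ∈ range k, (av j : ℤ) * (B : ℤ) ^ (m - j) =
      (B : ℤ) ^ (m + 1) * ∑ j ∈ range k, (av j : ℤ) * (B : ℤ) ^ (k - 1 - j) := by
    rw [Finset.mul_sum, Finset.mul_sum]
    refine sum_congr rfl fun j hj => ?_
    have hj' : j < k := mem_range.1 hj
    have hpow : (B : ℤ) ^ (m + 1) = (B : ℤ) ^ k * (B : ℤ) ^ (m + 1 - k) := by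
      rw [← pow_add]; congr 1; omega
    rw [show m - j = (m + 1 - k) + (k - 1 - j) by omega, pow_add, hpow]
    ring
  have h2 : (B : ℤ) ^ k * ((av k : ℤ) * (B : ℤ) ^ (m - k)) = (av k : ℤ) * (B : ℤ) ^ m := by
    have hpow : (B : ℤ) ^ m = (B : ℤ) ^ k * (B : ℤ) ^ (m - k) := by
      rw [← pow_add, Nat.add_sub_cancel' hk.le]
    rw [hpow]
    ring
  have h3 : (B : ℤ) ^ k * ∑ j ∈ Ico (k + 1) m, (av j : ℤ) * (B : ℤ) ^ (m - j) =
      ∑ j ∈ Ico (k + 1) m, (av j : ℤ) * (B : ℤ) ^ (m + k - j) := by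
    rw [Finset.mul_sum]
    refine sum_congr rfl fun j hj => ?_
    have hj' : k + 1 ≤ j ∧ j < m := by simpa using hj
    rw [show m + k - j = k + (m - j) by omega, pow_add]
    ring
  rw [hsplit, mul_add, mul_add, h1, h2, h3, add_assoc]

/-- The lower part is nonnegative. [folklore] -/
theorem tt_nonneg (k : ℕ) : 0 ≤ tt m av B k :=
  sum_nonneg fun j _ => by positivity

/-- The lower part is at most `A · B^{m-1}`. [folklore] -/
theorem tt_le (k : ℕ) (hB : 1 ≤ B) : tt m av B k ≤ (Av m av : ℤ) * (B : ℤ) ^ (m - 1) := by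
  unfold tt Av
  push_cast
  rw [Finset.sum_mul]
  calc ∑ j ∈ Ico (k + 1) m, (av j : ℤ) * (B : ℤ) ^ (m + k - j)
      ≤ ∑ j ∈ Ico (k + 1) m, (av j : ℤ) * (B : ℤ) ^ (m - 1) := by
        refine sum_le_sum fun j hj => ?_
        have hj' : k + 1 ≤ j ∧ j < m := by simpa using hj
        refine mul_le_mul_of_nonneg_left ?_ (by positivity)
        exact pow_le_pow_right₀ (by exact_mod_cast hB) (by omega)
    _ ≤ ∑ j ∈ range m, (av j : ℤ) * (B : ℤ) ^ (m - 1) := by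
        refine sum_le_sum_of_subset_of_nonneg (fun j hj => ?_) fun j _ _ => by positivity
        have hj' : k + 1 ≤ j ∧ j < m := by simpa using hj
        exact mem_range.2 hj'.2

/-- `q·y = B^{m+1} U + B^m L + T`. [folklore] -/
theorem sum_mul_yv (x : ℕ → ℤ) :
    (∑ k ∈ range m, x k * (B : ℤ) ^ k) * yv m av B =
      (B : ℤ) ^ (m + 1) * ∑ k ∈ range m, x k * uu av B k +
        (B : ℤ) ^ m * ∑ k ∈ range m, x k * (av k : ℤ) + ∑ k ∈ range m, x k * tt m av B k := by
  rw [Finset.sum_mul, Finset.mul_sum, Finset.mul_sum, ← Finset.sum_add_distrib, ← Finset.sum_add_distrib]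
  refine sum_congr rfl fun k hk => ?_
  rw [mul_assoc, pow_mul_yv (mem_range.1 hk)]
  ring

/-- `|T| ≤ m A B^{m-1}` for balanced digits. [folklore] -/
theorem abs_sum_tt_le {x : ℕ → ℤ} (hx : ∀ k < m, |x k| ≤ 1) (hB : 1 ≤ B) :
    |∑ k ∈ range m, x k * tt m av B k| ≤ (m : ℤ) * ((Av m av : ℤ) * (B : ℤ) ^ (m - 1)) := by
  calc |∑ k ∈ range m, x k * tt m av B k|
      ≤ ∑ k ∈ range m, |x k * tt m av B k| := abs_sum_le_sum_abs _ _
    _ ≤ ∑ k ∈ range m, ((Av m av : ℤ) * (B : ℤ) ^ (m - 1)) := by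
        refine sum_le_sum fun k hk => ?_
        have hk' := mem_range.1 hk
        rw [abs_mul, abs_of_nonneg (tt_nonneg k)]
        calc |x k| * tt m av B k ≤ 1 * tt m av B k :=
              mul_le_mul_of_nonneg_right (hx k hk') (tt_nonneg k)
          _ ≤ (Av m av : ℤ) * (B : ℤ) ^ (m - 1) := by rw [one_mul]; exact tt_le k hB
    _ = (m : ℤ) * ((Av m av : ℤ) * (B : ℤ) ^ (m - 1)) := by
        rw [sum_const, card_range, nsmul_eq_mul]

/-- `|L| ≤ A` for balanced digits. [folklore] -/
theorem abs_sum_mul_av_le {x : ℕ → ℤ} (hx : ∀ k < m, |x k| ≤ 1) :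
    |∑ k ∈ range m, x k * (av k : ℤ)| ≤ (Av m av : ℤ) := by
  unfold Av
  push_cast
  calc |∑ k ∈ range m, x k * (av k : ℤ)|
      ≤ ∑ k ∈ range m, |x k * (av k : ℤ)| := abs_sum_le_sum_abs _ _
    _ ≤ ∑ k ∈ range m, (av k : ℤ) := by
        refine sum_le_sum fun k hk => ?_
        rw [abs_mul, Nat.abs_cast]
        calc |x k| * (av k : ℤ) ≤ 1 * (av k : ℤ) :=
              mul_le_mul_of_nonneg_right (hx k (mem_range.1 hk)) (by positivity)
          _ = (av k : ℤ) := one_mul _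

/-- lower bound `|a| - |b| ≤ |a + b|`. [folklore] -/
theorem abs_sub_abs_le_abs_add' (a b : ℤ) : |a| - |b| ≤ |a + b| := by
  have h := abs_sub (a + b) b
  rw [add_sub_cancel_right] at h
  linarith

/-- **The equation coordinate**: for balanced digits `x`, the approximation condition of the
coordinate `2y / B^{m+1}` at `q = ∑ x_k B^k` holds iff `∑ x_k a_k = 0`. [folklore] -/
theorem eqCoord_iff {x : ℕ → ℤ} (hx : ∀ k < m, |x k| ≤ 1) (hB4 : 4 ≤ B) (hBe : Even B)
    (hBA : 2 * m * Av m av + 3 ≤ B) :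
    (∃ p : ℤ, |(∑ k ∈ range m, x k * (B : ℤ) ^ k) * (2 * yv m av B) - p * (B : ℤ) ^ (m + 1)| * ((B : ℤ) - 1)
        ≤ (B : ℤ) ^ (m + 1)) ↔
      ∑ k ∈ range m, x k * (av k : ℤ) = 0 := by
  rcases Nat.eq_zero_or_pos m with hm | hm
  · -- `m = 0`: everything vanishes
    subst hm
    simp only [range_zero, sum_empty, zero_mul, zero_sub, iff_true]
    exact ⟨0, by simp⟩
  have hB1 : (1 : ℕ) ≤ B := by omega
  set U := ∑ k ∈ range m, x k * uu av B k with hU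
  set L := ∑ k ∈ range m, x k * (av k : ℤ) with hL
  set T := ∑ k ∈ range m, x k * tt m av B k with hT
  have hqy : (∑ k ∈ range m, x k * (B : ℤ) ^ k) * (2 * yv m av B) =
      2 * ((B : ℤ) ^ (m + 1) * U + (B : ℤ) ^ m * L + T) := by
    rw [mul_left_comm, sum_mul_yv]
  have hTle : |T| ≤ (m : ℤ) * ((Av m av : ℤ) * (B : ℤ) ^ (m - 1)) := abs_sum_tt_le hx hB1
  have hLle : |L| ≤ (Av m av : ℤ) := abs_sum_mul_av_le hx
  have hBA' : 2 * (m : ℤ) * (Av m av : ℤ) + 3 ≤ (B : ℤ) := by exact_mod_cast hBA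
  have hB4' : (4 : ℤ) ≤ B := by exact_mod_cast hB4
  have hB1' : (0 : ℤ) ≤ (B : ℤ) - 1 := by linarith
  -- `m ≥ 1`: write `B^m = B·M`, `B^{m+1} = B·B·M`
  obtain ⟨m', rfl⟩ : ∃ m', m = m' + 1 := ⟨m - 1, by omega⟩
  simp only [Nat.add_sub_cancel] at hTle
  set M := (B : ℤ) ^ m' with hM
  have hMpos : 0 < M := by positivity
  have hpm : (B : ℤ) ^ (m' + 1) = (B : ℤ) * M := by rw [pow_succ]; ring
  have hpm1 : (B : ℤ) ^ (m' + 1 + 1) = (B : ℤ) * (B : ℤ) * M := by rw [pow_succ, pow_succ]; ring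
  set mA := ((m' + 1 : ℕ) : ℤ) * (Av (m' + 1) av : ℤ) with hmA
  have hmA0 : 0 ≤ mA := by positivity
  have hBmA : 2 * mA + 3 ≤ (B : ℤ) := by rw [hmA]; linarith
  have hTle' : |T| ≤ mA * M := by rw [hmA]; linarith
  constructor
  · rintro ⟨p, hp⟩
    by_contra hL0
    rw [hqy, hpm, hpm1] at hp
    -- `V := B (2U - p) + 2L` is even and nonzero, hence `|V| ≥ 2`
    set V := (B : ℤ) * (2 * U - p) + 2 * L with hV
    have hexpr : 2 * ((B : ℤ) * (B : ℤ) * M * U + (B : ℤ) * M * L + T) - p * ((B : ℤ) * (B : ℤ) * M) =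
        V * ((B : ℤ) * M) + 2 * T := by rw [hV]; ring
    rw [hexpr] at hp
    have hVne : V ≠ 0 := by
      intro hV0
      have hdvd : (B : ℤ) ∣ 2 * L := ⟨-(2 * U - p), by linarith⟩
      have hAmA : (Av (m' + 1) av : ℤ) ≤ mA := by
        rw [hmA]; push_cast; nlinarith
      have h2L : |2 * L| < (B : ℤ) := by
        rw [abs_mul, abs_two]
        linarith
      have := Int.eq_zero_of_abs_lt_dvd hdvd h2L
      exact hL0 (by linarith)
    have hVeven : Even V := by
      obtain ⟨c, hc⟩ := hBe
      refine ⟨(c : ℤ) * (2 * U - p) + L, ?_⟩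
      rw [hV, show (B : ℤ) = c + c by exact_mod_cast hc]
      ring
    have hV2 : (2 : ℤ) ≤ |V| := by
      obtain ⟨c, hc⟩ := hVeven
      have hc0 : c ≠ 0 := by rintro rfl; exact hVne (by simp [hc])
      rw [hc, ← two_mul, abs_mul, abs_two]
      have := Int.one_le_abs hc0
      linarith
    -- lower bound of the left-hand side
    have hBM : (0 : ℤ) < (B : ℤ) * M := by positivity
    have hlow : |V| * ((B : ℤ) * M) - 2 * |T| ≤ |V * ((B : ℤ) * M) + 2 * T| := by
      have h := abs_sub_abs_le_abs_add' (V * ((B : ℤ) * M)) (2 * T)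
      have e1 : |V * ((B : ℤ) * M)| = |V| * ((B : ℤ) * M) := by rw [abs_mul, abs_of_pos hBM]
      have e2 : |2 * T| = 2 * |T| := by rw [abs_mul, abs_two]
      linarith
    have h1a : 2 * ((B : ℤ) * M) ≤ |V| * ((B : ℤ) * M) := mul_le_mul_of_nonneg_right hV2 hBM.le
    have h1 : 2 * ((B : ℤ) * M) - 2 * (mA * M) ≤ |V| * ((B : ℤ) * M) - 2 * |T| := by linarith
    have hstep : (2 * ((B : ℤ) * M) - 2 * (mA * M)) * ((B : ℤ) - 1) ≤ (B : ℤ) * (B : ℤ) * M :=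
      calc _ ≤ (|V| * ((B : ℤ) * M) - 2 * |T|) * ((B : ℤ) - 1) := mul_le_mul_of_nonneg_right h1 hB1'
        _ ≤ |V * ((B : ℤ) * M) + 2 * T| * ((B : ℤ) - 1) := mul_le_mul_of_nonneg_right hlow hB1'
        _ ≤ _ := hp
    -- the scalar inequality `(2B - 2mA)(B-1) > B²`
    have hscal : (B : ℤ) * (B : ℤ) < (2 * (B : ℤ) - 2 * mA) * ((B : ℤ) - 1) := by nlinarith
    have h := mul_lt_mul_of_pos_right hscal hMpos
    have e : (2 * (B : ℤ) - 2 * mA) * ((B : ℤ) - 1) * M = (2 * ((B : ℤ) * M) - 2 * (mA * M)) * ((B : ℤ) - 1) := by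
      ring
    rw [e] at h
    linarith
  · intro hL0
    refine ⟨2 * U, ?_⟩
    rw [hqy, hL0, mul_zero, add_zero]
    have hexpr : 2 * ((B : ℤ) ^ (m' + 1 + 1) * U + T) - 2 * U * (B : ℤ) ^ (m' + 1 + 1) = 2 * T := by ring
    rw [hexpr, abs_mul, abs_two, hpm1]
    have hsc : 2 * mA * ((B : ℤ) - 1) ≤ (B : ℤ) * (B : ℤ) := by nlinarith
    have h2 := mul_le_mul_of_nonneg_right hsc hMpos.le
    have h3 : 2 * |T| * ((B : ℤ) - 1) ≤ 2 * (mA * M) * ((B : ℤ) - 1) :=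
      mul_le_mul_of_nonneg_right (by linarith) hB1'
    have e : 2 * (mA * M) * ((B : ℤ) - 1) = 2 * mA * ((B : ℤ) - 1) * M := by ring
    linarith


/-! ### Level 2: digits, the top digit, and the integer system -/

/-- Telescoping of the digits `x_k = P_k - B P_{k+1}`. [folklore] -/
theorem telescope (P : ℕ → ℤ) (B' : ℤ) :
    ∀ i : ℕ, P 0 - P i * B' ^ i = ∑ k ∈ range i, (P k - B' * P (k + 1)) * B' ^ k
  | 0 => by simp
  | i + 1 => by
      rw [Finset.sum_range_succ, ← telescope P B' i, pow_succ]
      ring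

/-- The digits read off approximation witnesses are balanced. [folklore] -/
theorem digit_abs_le_one (hB4 : 4 ≤ B) {q : ℤ} {P : ℕ → ℤ}
    (hP : ∀ i ≤ m, |q - P i * (B : ℤ) ^ i| * ((B : ℤ) - 1) ≤ (B : ℤ) ^ i) {k : ℕ} (hk : k < m) :
    |P k - (B : ℤ) * P (k + 1)| ≤ 1 := by
  have hB4' : (4 : ℤ) ≤ B := by exact_mod_cast hB4
  set M := (B : ℤ) ^ k with hM
  have hMpos : 0 < M := by positivity
  have h1 := hP k hk.le
  have h2 := hP (k + 1) hk
  rw [pow_succ] at h2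
  set xk := P k - (B : ℤ) * P (k + 1) with hxk
  have hx : xk * M = (q - P (k + 1) * (M * B)) - (q - P k * M) := by rw [hxk]; ring
  have habs : |xk| * M ≤ |q - P (k + 1) * (M * (B : ℤ))| + |q - P k * M| := by
    have e : |xk| * M = |xk * M| := by rw [abs_mul, abs_of_pos hMpos]
    rw [e, hx]
    exact abs_sub _ _
  have hB1 : (0 : ℤ) ≤ (B : ℤ) - 1 := by linarith
  have h3 : |xk| * M * ((B : ℤ) - 1) ≤ M * (B : ℤ) + M := by
    have := mul_le_mul_of_nonneg_right habs hB1
    linarith [add_mul (|q - P (k + 1) * (M * (B : ℤ))|) (|q - P k * M|) ((B : ℤ) - 1)]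
  by_contra hcon
  have h2le : 2 ≤ |xk| := by
    have := Int.add_one_le_iff.2 (not_le.1 hcon)
    linarith
  have : 2 * M * ((B : ℤ) - 1) ≤ M * (B : ℤ) + M := by nlinarith
  nlinarith

/-- The top witness vanishes: `1 ≤ q ≤ N` and `|q - p B^m| (B-1) ≤ B^m` force `p = 0`. [folklore] -/
theorem top_eq_zero (hB4 : 4 ≤ B) {q p : ℤ} (hq1 : 1 ≤ q) (hqN : q ≤ Nv m B)
    (h : |q - p * (B : ℤ) ^ m| * ((B : ℤ) - 1) ≤ (B : ℤ) ^ m) : p = 0 := by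
  have hB4' : (4 : ℤ) ≤ B := by exact_mod_cast hB4
  set M := (B : ℤ) ^ m with hM
  have hMpos : 0 < M := by positivity
  have hNv : (Nv m B : ℤ) * ((B : ℤ) - 1) = M - 1 := Nv_mul m B
  have hNv0 : (0 : ℤ) ≤ Nv m B := by positivity
  have hNvM : (Nv m B : ℤ) ≤ M - 1 := by nlinarith
  rcases lt_trichotomy p 0 with hp | hp | hp
  · have hp1 : p ≤ -1 := by omega
    have hpos : 0 < q - p * M := by nlinarith
    rw [abs_of_pos hpos] at h
    nlinarith
  · exact hp
  · have hp1 : 1 ≤ p := hp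
    have hneg : q - p * M < 0 := by nlinarith
    rw [abs_of_neg hneg] at h
    nlinarith

/-- `|∑_{k<n} x_k B^k| ≤ N_n` for balanced digits. [folklore] -/
theorem abs_sum_digits_le {n : ℕ} {x : ℕ → ℤ} (hx : ∀ k < n, |x k| ≤ 1) :
    |∑ k ∈ range n, x k * (B : ℤ) ^ k| ≤ (Nv n B : ℤ) := by
  unfold Nv
  push_cast
  calc |∑ k ∈ range n, x k * (B : ℤ) ^ k| ≤ ∑ k ∈ range n, |x k * (B : ℤ) ^ k| := abs_sum_le_sum_abs _ _
    _ ≤ ∑ k ∈ range n, (B : ℤ) ^ k := by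
        refine sum_le_sum fun k hk => ?_
        rw [abs_mul, abs_of_nonneg (by positivity : (0 : ℤ) ≤ (B : ℤ) ^ k)]
        calc |x k| * (B : ℤ) ^ k ≤ 1 * (B : ℤ) ^ k :=
              mul_le_mul_of_nonneg_right (hx k (mem_range.1 hk)) (by positivity)
          _ = (B : ℤ) ^ k := one_mul _

variable (m av B)

/-- Weak-partition solutions of `(a_j)_{j<m}`: balanced, nonzero, orthogonal to `a`.
[cite: vanEmdeBoas1981, Thm 1 (WEAK PARTITION)] -/
def IsWeakSol (x : ℕ → ℤ) : Prop :=
  (∀ k < m, |x k| ≤ 1) ∧ (∃ k < m, x k ≠ 0) ∧ ∑ k ∈ range m, x k * (av k : ℤ) = 0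

/-- Solubility of the weak-partition instance `(a_j)_{j<m}` (a predicate of the instance, not a named
fact: YES instances of van Emde Boas's WEAK PARTITION). [cite: vanEmdeBoas1981, Thm 1 (WEAK PARTITION)] -/
def HasWeakSol (m : ℕ) (av : ℕ → ℕ) : Prop := ∃ x : ℕ → ℤ, IsWeakSol m av x

/-- The GSA system of level 2 in integer form, at the numerator `q`. [folklore] -/
def IntSys (q : ℤ) : Prop :=
  (∃ p : ℤ, |q * (2 * yv m av B) - p * (B : ℤ) ^ (m + 1)| * ((B : ℤ) - 1) ≤ (B : ℤ) ^ (m + 1)) ∧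
    ∀ i < m, ∃ p : ℤ, |q - p * (B : ℤ) ^ (i + 1)| * ((B : ℤ) - 1) ≤ (B : ℤ) ^ (i + 1)

variable {m av B}

/-- Weak-partition solutions are closed under negation. [folklore] -/
theorem IsWeakSol.neg {x : ℕ → ℤ} (h : IsWeakSol m av x) : IsWeakSol m av (fun k => -x k) := by
  obtain ⟨h1, ⟨k, hk, hk0⟩, h3⟩ := h
  refine ⟨fun k hk => by rw [abs_neg]; exact h1 k hk, ⟨k, hk, neg_ne_zero.2 hk0⟩, ?_⟩
  simp only [neg_mul, sum_neg_distrib, h3, neg_zero]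

/-- Soundness of level 2: a solution of the integer system yields a weak-partition solution. [folklore] -/
theorem hasWeakSol_of_intSys (hB4 : 4 ≤ B) (hBe : Even B) (hBA : 2 * m * Av m av + 3 ≤ B)
    {q : ℤ} (hq1 : 1 ≤ q) (hqN : q ≤ Nv m B) (hsys : IntSys m av B q) : HasWeakSol m av := by
  obtain ⟨heq, hdig⟩ := hsys
  have hdig' : ∀ i : ℕ, ∃ p : ℤ, i < m → |q - p * (B : ℤ) ^ (i + 1)| * ((B : ℤ) - 1) ≤ (B : ℤ) ^ (i + 1) := by
    intro i
    by_cases hi : i < m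
    · obtain ⟨p, hp⟩ := hdig i hi
      exact ⟨p, fun _ => hp⟩
    · exact ⟨0, fun h => absurd h hi⟩
  choose P hP using hdig'
  -- witnesses `P' 0 = q`, `P' (i+1) = P i`
  set P' : ℕ → ℤ := fun i => Nat.casesOn i q P with hP'
  have hP'0 : P' 0 = q := rfl
  have hP's : ∀ i, P' (i + 1) = P i := fun i => rfl
  have hbound : ∀ i ≤ m, |q - P' i * (B : ℤ) ^ i| * ((B : ℤ) - 1) ≤ (B : ℤ) ^ i := by
    intro i hi
    cases i with
    | zero => simp [hP'0]
    | succ j => rw [hP's]; exact hP j (by omega)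
  set x : ℕ → ℤ := fun k => P' k - (B : ℤ) * P' (k + 1) with hxdef
  have hx1 : ∀ k < m, |x k| ≤ 1 := fun k hk => digit_abs_le_one hB4 hbound hk
  have htel : ∀ i, q - P' i * (B : ℤ) ^ i = ∑ k ∈ range i, x k * (B : ℤ) ^ k := fun i => by
    rw [← hP'0]; exact telescope P' (B : ℤ) i
  have htop : P' m = 0 := top_eq_zero hB4 hq1 hqN (hbound m le_rfl)
  have hq : q = ∑ k ∈ range m, x k * (B : ℤ) ^ k := by
    have := htel m
    rwa [htop, zero_mul, sub_zero] at this
  refine ⟨x, hx1, ?_, ?_⟩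
  · by_contra hall
    push Not at hall
    have : q = 0 := by
      rw [hq]
      exact sum_eq_zero fun k hk => by rw [hall k (mem_range.1 hk), zero_mul]
    omega
  · rw [hq] at heq
    exact (eqCoord_iff hx1 hB4 hBe hBA).1 heq

/-- Completeness of level 2, positive case. [folklore] -/
theorem intSys_of_isWeakSol_pos (hB4 : 4 ≤ B) (hBe : Even B) (hBA : 2 * m * Av m av + 3 ≤ B)
    {x : ℕ → ℤ} (hx : IsWeakSol m av x) (hpos : 0 < ∑ k ∈ range m, x k * (B : ℤ) ^ k) :
    ∃ q : ℤ, 1 ≤ q ∧ q ≤ Nv m B ∧ IntSys m av B q := by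
  obtain ⟨hx1, -, hx3⟩ := hx
  refine ⟨∑ k ∈ range m, x k * (B : ℤ) ^ k, hpos, ?_, ?_, ?_⟩
  · exact (le_abs_self _).trans (abs_sum_digits_le hx1)
  · exact (eqCoord_iff hx1 hB4 hBe hBA).2 hx3
  · intro i hi
    refine ⟨∑ k ∈ Ico (i + 1) m, x k * (B : ℤ) ^ (k - (i + 1)), ?_⟩
    have hsplit : ∑ k ∈ range m, x k * (B : ℤ) ^ k =
        ∑ k ∈ range (i + 1), x k * (B : ℤ) ^ k + ∑ k ∈ Ico (i + 1) m, x k * (B : ℤ) ^ k :=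
      (Finset.sum_range_add_sum_Ico _ (by omega : i + 1 ≤ m)).symm
    have hup : (∑ k ∈ Ico (i + 1) m, x k * (B : ℤ) ^ (k - (i + 1))) * (B : ℤ) ^ (i + 1) =
        ∑ k ∈ Ico (i + 1) m, x k * (B : ℤ) ^ k := by
      rw [Finset.sum_mul]
      refine sum_congr rfl fun k hk => ?_
      have hk' : i + 1 ≤ k ∧ k < m := by simpa using hk
      rw [mul_assoc, ← pow_add, Nat.sub_add_cancel hk'.1]
    rw [hsplit, ← hup, add_sub_cancel_right]
    have hle : |∑ k ∈ range (i + 1), x k * (B : ℤ) ^ k| ≤ (Nv (i + 1) B : ℤ) :=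
      abs_sum_digits_le fun k hk => hx1 k (by omega)
    have hB1 : (0 : ℤ) ≤ (B : ℤ) - 1 := by
      have : (4 : ℤ) ≤ B := by exact_mod_cast hB4
      linarith
    calc |∑ k ∈ range (i + 1), x k * (B : ℤ) ^ k| * ((B : ℤ) - 1)
        ≤ (Nv (i + 1) B : ℤ) * ((B : ℤ) - 1) := mul_le_mul_of_nonneg_right hle hB1
      _ = (B : ℤ) ^ (i + 1) - 1 := Nv_mul (i + 1) B
      _ ≤ (B : ℤ) ^ (i + 1) := by linarith

/-- **Level 2**: the integer system is soluble in `[1, N]` iff the weak-partition instance is. [folklore] -/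
theorem exists_intSys_iff (hB4 : 4 ≤ B) (hBe : Even B) (hBA : 2 * m * Av m av + 3 ≤ B) :
    (∃ q : ℤ, 1 ≤ q ∧ q ≤ Nv m B ∧ IntSys m av B q) ↔ HasWeakSol m av := by
  constructor
  · rintro ⟨q, hq1, hqN, hsys⟩
    exact hasWeakSol_of_intSys hB4 hBe hBA hq1 hqN hsys
  · rintro ⟨x, hx⟩
    have hB0 : (0 : ℤ) < B := by
      have : (4 : ℤ) ≤ B := by exact_mod_cast hB4
      linarith
    have hne : ∑ k ∈ range m, x k * (B : ℤ) ^ k ≠ 0 := by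
      obtain ⟨k, hk, hk0⟩ := hx.2.1
      refine sum_digits_ne_zero hB0 (fun e he => ?_) hk hk0
      have : (4 : ℤ) ≤ B := by exact_mod_cast hB4
      linarith [hx.1 e he]
    rcases lt_or_gt_of_ne hne with hneg | hpos
    · refine intSys_of_isWeakSol_pos hB4 hBe hBA hx.neg ?_
      simp only [neg_mul, sum_neg_distrib]
      linarith
    · exact intSys_of_isWeakSol_pos hB4 hBe hBA hx hpos


/-! ### Level 2: the GSA instance and its `Yes` -/

/-- Rescaling a digit coordinate: `|q B^{m-j} - p B^{m+1}| (B-1) ≤ B^{m+1}` iff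
`|q - p B^{j+1}| (B-1) ≤ B^{j+1}`. [folklore] -/
theorem digitCoord_iff (hB : 1 ≤ B) {j : ℕ} (hj : j < m) (q : ℤ) :
    (∃ p : ℤ, |q * (B : ℤ) ^ (m - j) - p * (B : ℤ) ^ (m + 1)| * ((B : ℤ) - 1) ≤ (B : ℤ) ^ (m + 1)) ↔
      ∃ p : ℤ, |q - p * (B : ℤ) ^ (j + 1)| * ((B : ℤ) - 1) ≤ (B : ℤ) ^ (j + 1) := by
  have hpow : (B : ℤ) ^ (m + 1) = (B : ℤ) ^ (m - j) * (B : ℤ) ^ (j + 1) := by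
    rw [← pow_add]; congr 1; omega
  have hpos : (0 : ℤ) < (B : ℤ) ^ (m - j) := by
    have : (1 : ℤ) ≤ B := by exact_mod_cast hB
    positivity
  refine exists_congr fun p => ?_
  have e : q * (B : ℤ) ^ (m - j) - p * (B : ℤ) ^ (m + 1) = (B : ℤ) ^ (m - j) * (q - p * (B : ℤ) ^ (j + 1)) := by
    rw [hpow]; ring
  rw [e, abs_mul, abs_of_pos hpos, hpow, mul_assoc]
  exact mul_le_mul_iff_right₀ hpos

/-- The approximation condition `‖q T / b‖ ≤ 1/(B-1)` in integers. [folklore] -/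
theorem dist_le_iff (b : ℕ) (hb : 0 < b) (hB : 1 < B) (q : ℕ) (T : ℤ) :
    distNearestInt ((q : ℚ) * (T : ℚ) / (b : ℚ)) ≤ 1 / ((B : ℚ) - 1) ↔
      ∃ p : ℤ, |(q : ℤ) * T - p * b| * ((B : ℤ) - 1) ≤ b := by
  rw [distNearestInt_le_iff_exists_int]
  refine exists_congr fun p => ?_
  have hb' : (0 : ℚ) < b := by exact_mod_cast hb
  have hB' : (0 : ℚ) < (B : ℚ) - 1 := by
    have : (1 : ℚ) < B := by exact_mod_cast hB
    linarith
  have e : (q : ℚ) * (T : ℚ) / (b : ℚ) - (p : ℚ) = (((q : ℤ) * T - p * b : ℤ) : ℚ) / (b : ℚ) := by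
    push_cast
    field_simp
  rw [e, abs_div, abs_of_pos hb', div_le_div_iff₀ hb' hB', one_mul]
  constructor
  · intro h; exact_mod_cast h
  · intro h; exact_mod_cast h

/-- `∀` over the entries of a list. [folklore] -/
theorem forall_get_iff {α : Type} (L : List α) (P : α → Prop) :
    (∀ i : Fin L.length, P (L.get i)) ↔ ∀ t ∈ L, P t := by
  constructor
  · intro h t ht
    obtain ⟨i, rfl⟩ := List.mem_iff_get.1 ht
    exact h i
  · intro h i
    exact h _ (List.get_mem L i)

/-- The base `B = 4 (m·A + 1)` of level 2 for the list `a` (even, `≥ 4`, `≥ 2mA + 3`). [folklore] -/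
def baseOf (a : List ℕ) : ℕ := 4 * (a.length * a.sum + 1)

/-- `4 ≤ B`. [folklore] -/
theorem four_le_baseOf (a : List ℕ) : 4 ≤ baseOf a := by
  unfold baseOf
  omega

/-- `B` is even. [folklore] -/
theorem even_baseOf (a : List ℕ) : Even (baseOf a) :=
  ⟨2 * (a.length * a.sum + 1), by unfold baseOf; ring⟩

/-- The sum of a list as an index sum. [folklore] -/
theorem sum_range_getD : ∀ a : List ℕ, ∑ j ∈ range a.length, a.getD j 0 = a.sum
  | [] => by simp
  | x :: a => by
      rw [List.length_cons, Finset.sum_range_succ', List.sum_cons, ← sum_range_getD a]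
      simp [add_comm]

/-- `A` of the list entries is the sum of the list. [folklore] -/
theorem Av_getD (a : List ℕ) : Av a.length (fun j => a.getD j 0) = a.sum := sum_range_getD a

/-- `2 m A + 3 ≤ B`. [folklore] -/
theorem bound_baseOf (a : List ℕ) : 2 * a.length * Av a.length (fun j => a.getD j 0) + 3 ≤ baseOf a := by
  rw [Av_getD]
  unfold baseOf
  have : 2 * a.length * a.sum = 2 * (a.length * a.sum) := by ring
  omega

/-- The numerators of level 2: `2y` and the powers `B^{m-j}`, `j < m`. [folklore] -/
def numList (a : List ℕ) : List ℤ :=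
  (2 * yv a.length (fun j => a.getD j 0) (baseOf a)) ::
    (List.range a.length).map fun j => ((baseOf a : ℤ) ^ (a.length - j))

/-- **The GSA instance of level 2** attached to a weak-partition instance `a` (`m = |a|`, `B = baseOf a`):
dimension `m + 1`, numerators `numList a` (`2y`, then `B^{m-j}`), common denominator `B^{m+1}`, bound
`N = Σ_{k<m} B^k`, tolerance `ε = 1/(B-1)` — a positional (single large base) variant of Lagarias's
residue encoding of the digits of `q`. [folklore] -/
def toInstance (a : List ℕ) : SimultaneousApproxInstance :=
  (⟨(numList a).length, (numList a).get⟩, baseOf a ^ (a.length + 1), Nv a.length (baseOf a),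
    1 / ((baseOf a : ℚ) - 1))

/-- **Level 2 for lists**: the GSA instance is a YES instance iff the weak-partition instance is soluble.
[folklore] -/
theorem yes_toInstance_iff (a : List ℕ) :
    (toInstance a).Yes ↔ HasWeakSol a.length (fun j => a.getD j 0) := by
  set m := a.length with hm
  set av : ℕ → ℕ := fun j => a.getD j 0 with hav
  set B := baseOf a with hBdef
  have hB4 : 4 ≤ B := four_le_baseOf a
  have hB1 : 1 ≤ B := by omega
  have hB1' : 1 < B := by omega
  have hb : 0 < B ^ (m + 1) := by positivity
  rw [← exists_intSys_iff hB4 (even_baseOf a) (bound_baseOf a)]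
  show (∃ q : ℕ, 1 ≤ q ∧ q ≤ Nv m B ∧ ∀ i : Fin (numList a).length,
      distNearestInt ((q : ℚ) * (((numList a).get i : ℤ) : ℚ) / ((B ^ (m + 1) : ℕ) : ℚ)) ≤ 1 / ((B : ℚ) - 1)) ↔ _
  have key : ∀ q : ℕ, (∀ i : Fin (numList a).length,
      distNearestInt ((q : ℚ) * (((numList a).get i : ℤ) : ℚ) / ((B ^ (m + 1) : ℕ) : ℚ)) ≤ 1 / ((B : ℚ) - 1)) ↔
      IntSys m av B q := by
    intro q
    refine (forall_get_iff (numList a) (fun t : ℤ =>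
      distNearestInt ((q : ℚ) * (t : ℚ) / ((B ^ (m + 1) : ℕ) : ℚ)) ≤ 1 / ((B : ℚ) - 1))).trans ?_
    simp only [numList, List.forall_mem_cons, List.forall_mem_map, List.mem_range, dist_le_iff _ hb hB1']
    push_cast
    refine and_congr Iff.rfl (forall_congr' fun j => forall_congr' fun hj => ?_)
    exact digitCoord_iff hB1 hj q
  constructor
  · rintro ⟨q, hq1, hqN, h⟩
    exact ⟨q, by exact_mod_cast hq1, by exact_mod_cast hqN, (key q).1 h⟩
  · rintro ⟨q, hq1, hqN, h⟩
    refine ⟨q.toNat, ?_, ?_, (key q.toNat).2 ?_⟩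
    · omega
    · have : (q.toNat : ℤ) = q := Int.toNat_of_nonneg (by omega)
      exact_mod_cast this ▸ hqN
    · rwa [Int.toNat_of_nonneg (by omega)]

end LevelTwo


/-! ### Level 1: PARTITION → weak partition (the gadget) -/

section LevelOne

open Literature.Computability.Complexity Literature.Computability.Complexity.Knapsack

/-- The base `D = W + 5` of the gadget (`W = Σ w`). [folklore] -/
def gBase (w : List ℕ) : ℕ := w.sum + 5

/-- The powers `D^{k+1}`, `k < n`. [folklore] -/
def gPows (w : List ℕ) : List ℕ := (List.range w.length).map fun k => gBase w ^ (k + 1)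

/-- The item numbers `w_k + D^{k+1}`. [folklore] -/
def gItems (w : List ℕ) : List ℕ := (List.range w.length).map fun k => w.getD k 0 + gBase w ^ (k + 1)

/-- The slack numbers `2 D^{k+1}`. [folklore] -/
def gSlacks (w : List ℕ) : List ℕ := (List.range w.length).map fun k => 2 * gBase w ^ (k + 1)

/-- **The gadget** `z :: (items ++ slacks)`, `z = Σ_k D^{k+1}`. [folklore] -/
def gadget (w : List ℕ) : List ℕ := (gPows w).sum :: (gItems w ++ gSlacks w)

/-- The gadget has `2n + 1` numbers. [folklore] -/
theorem length_gadget (w : List ℕ) : (gadget w).length = w.length + w.length + 1 := by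
  simp [gadget, gItems, gSlacks]

/-- Indexing a map over `range`. [folklore] -/
theorem getD_map_range {β : Type} (g : ℕ → β) (d : β) {n k : ℕ} (hk : k < n) :
    ((List.range n).map g).getD k d = g k := by
  rw [List.getD_eq_getElem _ _ (by simpa using hk), List.getElem_map, List.getElem_range]

/-- The sum of a map over `range` is a `Finset.range` sum. [folklore] -/
theorem sum_map_range {β : Type} [AddCommMonoid β] (g : ℕ → β) :
    ∀ n : ℕ, ((List.range n).map g).sum = ∑ k ∈ range n, g k
  | 0 => by simp
  | n + 1 => by rw [List.range_succ, List.map_append, List.sum_append, sum_map_range g n,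
      Finset.sum_range_succ]; simp

/-- Entry `0` of the gadget: `z = Σ_k D^{k+1}`. [folklore] -/
theorem gadget_getD_zero (w : List ℕ) : (gadget w).getD 0 0 = ∑ k ∈ range w.length, gBase w ^ (k + 1) := by
  rw [gadget, List.getD_cons_zero, gPows, sum_map_range]

/-- Entries `1 … n` of the gadget: the items `w_k + D^{k+1}`. [folklore] -/
theorem gadget_getD_item (w : List ℕ) {k : ℕ} (hk : k < w.length) :
    (gadget w).getD (k + 1) 0 = w.getD k 0 + gBase w ^ (k + 1) := by
  rw [gadget, List.getD_cons_succ, List.getD_append _ _ _ _ (by simpa [gItems] using hk), gItems,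
    getD_map_range _ _ hk]

/-- Entries `n+1 … 2n` of the gadget: the slacks `2 D^{k+1}`. [folklore] -/
theorem gadget_getD_slack (w : List ℕ) {k : ℕ} (hk : k < w.length) :
    (gadget w).getD (w.length + k + 1) 0 = 2 * gBase w ^ (k + 1) := by
  rw [gadget, show w.length + k + 1 = (w.length + k) + 1 from rfl, List.getD_cons_succ,
    List.getD_append_right _ _ _ _ (by simp [gItems])]
  simp only [gItems, List.length_map, List.length_range, Nat.add_sub_cancel_left]
  rw [gSlacks, getD_map_range _ _ hk]

/-- The weighted item sum `Σ_k x_{k+1} w_k`. [folklore] -/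
def wSum (w : List ℕ) (x : ℕ → ℤ) : ℤ := ∑ k ∈ range w.length, x (k + 1) * (w.getD k 0 : ℤ)

/-- The digit columns `x_0 + x_{k+1} + 2 x_{n+k+1}`. [folklore] -/
def colSum (w : List ℕ) (x : ℕ → ℤ) (k : ℕ) : ℤ := x 0 + x (k + 1) + 2 * x (w.length + k + 1)

/-- **Key identity**: the weighted sum of the gadget splits into the item column and the digit columns.
[folklore] -/
theorem sum_gadget (w : List ℕ) (x : ℕ → ℤ) :
    ∑ i ∈ range (gadget w).length, x i * ((gadget w).getD i 0 : ℤ) =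
      wSum w x + ∑ k ∈ range w.length, colSum w x k * (gBase w : ℤ) ^ (k + 1) := by
  rw [length_gadget, Finset.sum_range_succ', Finset.sum_range_add, gadget_getD_zero]
  have h1 : ∑ i ∈ range w.length, x (i + 1) * ((gadget w).getD (i + 1) 0 : ℤ) =
      ∑ k ∈ range w.length, (x (k + 1) * (w.getD k 0 : ℤ) + x (k + 1) * (gBase w : ℤ) ^ (k + 1)) := by
    refine sum_congr rfl fun k hk => ?_
    rw [gadget_getD_item w (mem_range.1 hk)]; push_cast; ring
  have h2 : ∑ i ∈ range w.length, x (w.length + i + 1) * ((gadget w).getD (w.length + i + 1) 0 : ℤ) =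
      ∑ k ∈ range w.length, 2 * x (w.length + k + 1) * (gBase w : ℤ) ^ (k + 1) := by
    refine sum_congr rfl fun k hk => ?_
    rw [gadget_getD_slack w (mem_range.1 hk)]; push_cast; ring
  rw [h1, h2]
  unfold wSum colSum
  push_cast
  rw [Finset.mul_sum, ← Finset.sum_add_distrib, ← Finset.sum_add_distrib, ← Finset.sum_add_distrib]
  exact sum_congr rfl fun k _ => by ring

/-- The digit sequence of the key identity: item column, then the digit columns. [folklore] -/
def digitSeq (w : List ℕ) (x : ℕ → ℤ) : ℕ → ℤ
  | 0 => wSum w x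
  | k + 1 => colSum w x k

/-- The same identity in digit form. [folklore] -/
theorem sum_gadget_digits (w : List ℕ) (x : ℕ → ℤ) :
    ∑ i ∈ range (gadget w).length, x i * ((gadget w).getD i 0 : ℤ) =
      ∑ e ∈ range (w.length + 1), digitSeq w x e * (gBase w : ℤ) ^ e := by
  rw [sum_gadget, Finset.sum_range_succ']
  simp [digitSeq, add_comm]

/-- Masked sums as index sums. [folklore] -/
theorem maskSum_eq_sum : ∀ (μ : List Bool) (w : List ℕ),
    (maskSum μ w : ℤ) = ∑ k ∈ range w.length, if μ.getD k false then (w.getD k 0 : ℤ) else 0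
  | μ, [] => by simp
  | [], a :: l => by simp
  | b :: μ, a :: l => by
      rw [maskSum_cons_cons, List.length_cons, Finset.sum_range_succ']
      simp only [List.getD_cons_succ, List.getD_cons_zero]
      rw [← maskSum_eq_sum μ l]
      cases b <;> simp [add_comm]

/-- A signed item sum is twice the positively signed part minus the total. [folklore] -/
theorem sum_sign_eq (w : List ℕ) (c : ℕ → Bool) :
    ∑ k ∈ range w.length, (if c k then (1 : ℤ) else -1) * (w.getD k 0 : ℤ) =
      2 * (∑ k ∈ range w.length, if c k then (w.getD k 0 : ℤ) else 0) - w.sum := by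
  rw [← sum_range_getD w]
  push_cast
  rw [Finset.mul_sum, ← Finset.sum_sub_distrib]
  refine sum_congr rfl fun k _ => ?_
  cases c k <;> simp [two_mul]

/-- Soundness of the gadget. [folklore] -/
theorem partition_of_hasWeakSol (w : List ℕ)
    (h : HasWeakSol (gadget w).length (fun i => (gadget w).getD i 0)) : w ∈ partitionSet := by
  obtain ⟨x, hx1, hx2, hx3⟩ := h
  rw [length_gadget] at hx1 hx2
  have hD : (0 : ℤ) < gBase w := by unfold gBase; positivity
  -- the digits are small
  have hsmall : ∀ e < w.length + 1, |digitSeq w x e| < gBase w := by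
    intro e he
    cases e with
    | zero =>
      show |wSum w x| < gBase w
      unfold wSum gBase
      rw [Nat.cast_add, Nat.cast_ofNat]
      calc |∑ k ∈ range w.length, x (k + 1) * (w.getD k 0 : ℤ)|
          ≤ ∑ k ∈ range w.length, |x (k + 1) * (w.getD k 0 : ℤ)| := abs_sum_le_sum_abs _ _
        _ ≤ ∑ k ∈ range w.length, (w.getD k 0 : ℤ) := by
            refine sum_le_sum fun k hk => ?_
            rw [abs_mul, Nat.abs_cast]
            calc |x (k + 1)| * (w.getD k 0 : ℤ) ≤ 1 * (w.getD k 0 : ℤ) :=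
                  mul_le_mul_of_nonneg_right (hx1 (k + 1) (by have := mem_range.1 hk; omega)) (by positivity)
              _ = _ := one_mul _
        _ = (w.sum : ℤ) := by exact_mod_cast sum_range_getD w
        _ < (w.sum : ℤ) + 5 := by linarith
    | succ k =>
      show |colSum w x k| < gBase w
      unfold colSum gBase
      have h0 := abs_le.1 (hx1 0 (by omega))
      have h1 := abs_le.1 (hx1 (k + 1) (by omega))
      have h2 := abs_le.1 (hx1 (w.length + k + 1) (by omega))
      have h5 : (5 : ℤ) ≤ ((w.sum + 5 : ℕ) : ℤ) := by exact_mod_cast Nat.le_add_left 5 w.sum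
      rw [abs_lt]
      constructor <;> linarith [h0.1, h0.2, h1.1, h1.2, h2.1, h2.2]
  -- all digit columns vanish
  have hdig := digits_eq_zero hD (w.length + 1) (digitSeq w x) hsmall
    (by rw [← sum_gadget_digits]; exact hx3)
  have hw0 : wSum w x = 0 := hdig 0 (by omega)
  have hcol : ∀ k < w.length, x 0 + x (k + 1) + 2 * x (w.length + k + 1) = 0 :=
    fun k hk => hdig (k + 1) (by omega)
  -- `x 0 ≠ 0`
  have hx0 : x 0 ≠ 0 := by
    intro h0
    obtain ⟨i, hi, hine⟩ := hx2
    apply hine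
    have hitem : ∀ k < w.length, x (k + 1) = 0 ∧ x (w.length + k + 1) = 0 := by
      intro k hk
      have hc := hcol k hk
      rw [h0, zero_add] at hc
      have hb := abs_le.1 (hx1 (k + 1) (by omega))
      have hb' := abs_le.1 (hx1 (w.length + k + 1) (by omega))
      constructor <;> omega
    rcases Nat.lt_or_ge i (w.length + 1) with hi1 | hi1
    · rcases Nat.eq_zero_or_pos i with rfl | hipos
      · exact h0
      · obtain ⟨k, rfl⟩ : ∃ k, i = k + 1 := ⟨i - 1, by omega⟩
        exact (hitem k (by omega)).1
    · obtain ⟨k, rfl⟩ : ∃ k, i = w.length + k + 1 := ⟨i - w.length - 1, by omega⟩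
      exact (hitem k (by omega)).2
  -- the items carry signs `±1`
  have hsign : ∀ k < w.length, x (k + 1) = if x (k + 1) = 1 then 1 else -1 := by
    intro k hk
    have hc := hcol k hk
    have hb0 := abs_le.1 (hx1 0 (by omega))
    have hb := abs_le.1 (hx1 (k + 1) (by omega))
    have hb' := abs_le.1 (hx1 (w.length + k + 1) (by omega))
    split_ifs with h
    · exact h
    · omega
  -- the mask of positive signs selects half of the total
  set μ : List Bool := (List.range w.length).map fun k => decide (x (k + 1) = 1) with hμ
  have hmask : (2 : ℤ) * (maskSum μ w : ℤ) = w.sum := by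
    have hs := sum_sign_eq w (fun k => decide (x (k + 1) = 1))
    have hl : ∑ k ∈ range w.length, (if decide (x (k + 1) = 1) then (1 : ℤ) else -1) * (w.getD k 0 : ℤ) =
        wSum w x := by
      unfold wSum
      refine sum_congr rfl fun k hk => ?_
      congr 1
      rw [hsign k (mem_range.1 hk)]
      by_cases h : x (k + 1) = 1 <;> simp [h]
    have hm : (maskSum μ w : ℤ) =
        ∑ k ∈ range w.length, if decide (x (k + 1) = 1) then (w.getD k 0 : ℤ) else 0 := by
      rw [maskSum_eq_sum]
      refine sum_congr rfl fun k hk => ?_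
      rw [hμ, getD_map_range _ _ (mem_range.1 hk)]
    rw [hl, hw0] at hs
    rw [hm]
    linarith
  obtain ⟨l', hl', hs'⟩ := exists_sublist_of_mask μ w
  refine ⟨l', hl', ?_⟩
  have : (2 : ℤ) * (l'.sum : ℤ) = w.sum := by rw [hs']; exact hmask
  exact_mod_cast this

/-- The weak-partition solution attached to a mask (completeness of the gadget). [folklore] -/
def xOfMask (n : ℕ) (μ : List Bool) (i : ℕ) : ℤ :=
  if i = 0 then -1
  else if i ≤ n then (if μ.getD (i - 1) false then 1 else -1)
  else if i ≤ n + n then (if μ.getD (i - n - 1) false then 0 else 1)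
  else 0

/-- The `z`-coordinate of `xOfMask` is `-1`. [folklore] -/
theorem xOfMask_zero (n : ℕ) (μ : List Bool) : xOfMask n μ 0 = -1 := rfl

/-- The item coordinates of `xOfMask` are the signs of the mask. [folklore] -/
theorem xOfMask_item (n : ℕ) (μ : List Bool) {k : ℕ} (hk : k < n) :
    xOfMask n μ (k + 1) = if μ.getD k false then 1 else -1 := by
  unfold xOfMask
  rw [if_neg (by omega), if_pos (by omega), Nat.add_sub_cancel]

/-- The slack coordinates of `xOfMask`. [folklore] -/
theorem xOfMask_slack (n : ℕ) (μ : List Bool) {k : ℕ} (hk : k < n) :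
    xOfMask n μ (n + k + 1) = if μ.getD k false then 0 else 1 := by
  unfold xOfMask
  rw [if_neg (by omega), if_neg (by omega), if_pos (by omega), show n + k + 1 - n - 1 = k by omega]

/-- `xOfMask` is balanced. [folklore] -/
theorem abs_xOfMask_le (n : ℕ) (μ : List Bool) (i : ℕ) : |xOfMask n μ i| ≤ 1 := by
  unfold xOfMask
  split_ifs <;> simp

/-- Completeness of the gadget. [folklore] -/
theorem hasWeakSol_of_partition (w : List ℕ) (h : w ∈ partitionSet) :
    HasWeakSol (gadget w).length (fun i => (gadget w).getD i 0) := by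
  obtain ⟨l', hl', hs⟩ := h
  obtain ⟨μ, hμ, hsum⟩ := exists_mask_of_sublist hl'
  set n := w.length with hn
  refine ⟨xOfMask n μ, fun i _ => abs_xOfMask_le n μ i, ⟨0, by rw [length_gadget]; omega, by
    rw [xOfMask_zero]; norm_num⟩, ?_⟩
  rw [sum_gadget]
  have hcol : ∀ k < n, colSum w (xOfMask n μ) k = 0 := by
    intro k hk
    unfold colSum
    rw [xOfMask_zero, xOfMask_item n μ hk, xOfMask_slack n μ hk]
    cases μ.getD k false <;> simp
  have hw : wSum w (xOfMask n μ) = 0 := by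
    unfold wSum
    have hs' := sum_sign_eq w (fun k => μ.getD k false)
    have hl : ∑ k ∈ range w.length, (if μ.getD k false then (1 : ℤ) else -1) * (w.getD k 0 : ℤ) =
        ∑ k ∈ range w.length, xOfMask n μ (k + 1) * (w.getD k 0 : ℤ) :=
      sum_congr rfl fun k hk => by rw [xOfMask_item n μ (mem_range.1 hk)]
    rw [← hl, hs', ← maskSum_eq_sum, hsum]
    have : (2 : ℤ) * (l'.sum : ℤ) = w.sum := by exact_mod_cast hs
    linarith
  rw [hw, zero_add]
  exact sum_eq_zero fun k hk => by rw [hcol k (mem_range.1 hk), zero_mul]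

/-- **Level 1**: the gadget is a soluble weak-partition instance iff `w ∈ PARTITION`. [folklore] -/
theorem hasWeakSol_gadget_iff (w : List ℕ) :
    HasWeakSol (gadget w).length (fun i => (gadget w).getD i 0) ↔ w ∈ partitionSet :=
  ⟨partition_of_hasWeakSol w, hasWeakSol_of_partition w⟩

/-- **The reduction is correct**: `w ∈ PARTITION` iff the GSA instance of the gadget is a YES instance.
[folklore] -/
theorem partition_iff_yes (w : List ℕ) : w ∈ partitionSet ↔ (toInstance (gadget w)).Yes := by
  rw [yes_toInstance_iff, hasWeakSol_gadget_iff]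

end LevelOne


/-! ### The reduction on codes: typed polynomial time (`CodeFP`) -/

section Machine

open _root_.Computability
open Literature.Computability.Complexity Literature.Computability.Complexity.CodeFP
open Literature.Algebra.EuclideanLattices (encodeRat intVecEncoding encodingIntVecFin)

/-- The code of PARTITION instances: headed lists of binary numerals. [folklore] -/
abbrev inE : List ℕ → List Bool := listE natE

/-- The context of the level-1 maps: `(w, (D, 1ⁿ))`. [folklore] -/
abbrev ctxE : List ℕ × (ℕ × ℕ) → List Bool := pairE (rawE natE) (pairE natE unE)

/-- `w ↦ 1^{|w|}`. [folklore] -/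
theorem codeFP_length : CodeFP inE unE (fun w : List ℕ => w.length) :=
  ((ulength natE).comp (rawOfList natE)).congr fun _ => rfl

/-- `w ↦ D = Σ w + 5`. [folklore] -/
theorem codeFP_gBase : CodeFP inE natE gBase :=
  (natAdd.comp ((natSum.comp (rawOfList natE)).pair (CodeFP.const inE 5))).congr fun _ => rfl

/-- `w ↦ (w, (D, 1ⁿ))`. [folklore] -/
theorem codeFP_ctx : CodeFP inE ctxE (fun w => (w, (gBase w, w.length))) :=
  ((rawOfList natE).pair (codeFP_gBase.pair codeFP_length)).congr fun _ => rfl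

/-- `w ↦ [0, …, n-1]`. [folklore] -/
theorem codeFP_range : CodeFP inE (rawE natE) (fun w => List.range w.length) :=
  urange.comp codeFP_length

/-- On `((w, (D, 1ⁿ)), k)`: the power `D^{min k n + 1}`. [folklore] -/
theorem codeFP_powItem : CodeFP (pairE ctxE natE) natE (fun t => t.1.2.1 ^ (min t.2 t.1.2.2 + 1)) :=
  natPow.comp ((CodeFP.fst _ _).snd'.fst'.pair
    (unSucc.comp (unOfNatMin.comp ((CodeFP.fst _ _).snd'.snd'.pair (CodeFP.snd _ _)))))

/-- On `((w, (D, 1ⁿ)), k)`: `w_k + D^{min k n + 1}`. [folklore] -/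
theorem codeFP_item : CodeFP (pairE ctxE natE) natE
    (fun t => t.1.1.getD t.2 0 + t.1.2.1 ^ (min t.2 t.1.2.2 + 1)) :=
  natAdd.comp (((rawGetD natE (d := 0) rfl).comp ((CodeFP.fst _ _).fst'.pair (CodeFP.snd _ _))).pair
    codeFP_powItem)

/-- On `((w, (D, 1ⁿ)), k)`: `2 D^{min k n + 1}`. [folklore] -/
theorem codeFP_slack : CodeFP (pairE ctxE natE) natE (fun t => 2 * t.1.2.1 ^ (min t.2 t.1.2.2 + 1)) :=
  natMul.comp ((CodeFP.const _ 2).pair codeFP_powItem)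

/-- Capping the index at the length changes nothing on `range`. [folklore] -/
theorem map_range_min_congr {β : Type} (n : ℕ) (f : ℕ → β) :
    (List.range n).map (fun k => f (min k n)) = (List.range n).map f :=
  List.map_congr_left fun k hk => by rw [min_eq_left (List.mem_range.1 hk).le]

/-- `w ↦ gPows w`. [folklore] -/
theorem codeFP_gPows : CodeFP inE (rawE natE) gPows :=
  ((CodeFP.map codeFP_powItem).comp (codeFP_ctx.pair codeFP_range)).congr fun w =>
    map_range_min_congr w.length (fun k => gBase w ^ (k + 1))

/-- `w ↦ gItems w`. [folklore] -/
theorem codeFP_gItems : CodeFP inE (rawE natE) gItems :=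
  ((CodeFP.map codeFP_item).comp (codeFP_ctx.pair codeFP_range)).congr fun w =>
    List.map_congr_left fun k hk => by
      dsimp only
      rw [min_eq_left (List.mem_range.1 hk).le]

/-- `w ↦ gSlacks w`. [folklore] -/
theorem codeFP_gSlacks : CodeFP inE (rawE natE) gSlacks :=
  ((CodeFP.map codeFP_slack).comp (codeFP_ctx.pair codeFP_range)).congr fun w =>
    map_range_min_congr w.length (fun k => 2 * gBase w ^ (k + 1))

/-- **`w ↦ gadget w`** (raw list of numerals). [cite: AroraBarak2009, §1.3] -/
theorem codeFP_gadget : CodeFP inE (rawE natE) gadget :=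
  ((rawCons natE).comp ((natSum.comp codeFP_gPows).pair ((rawAppend natE).comp
    (codeFP_gItems.pair codeFP_gSlacks)))).congr fun _ => rfl

/-! Level 2 on codes: `a ↦` the GSA instance data -/

/-- The code of raw lists of numerals (level-2 input). [folklore] -/
abbrev aE : List ℕ → List Bool := rawE natE

/-- The context of the level-2 maps: `(a, (B, 1ᵐ))`. [folklore] -/
abbrev ctx2E : List ℕ × (ℕ × ℕ) → List Bool := pairE (rawE natE) (pairE natE unE)

/-- `a ↦ B = 4 (m A + 1)`. [folklore] -/
theorem codeFP_baseOf : CodeFP aE natE baseOf :=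
  (natMul.comp ((CodeFP.const aE 4).pair (natAdd.comp ((natMul.comp ((natOfUn.comp (ulength natE)).pair
    natSum)).pair (CodeFP.const aE 1))))).congr fun _ => rfl

/-- `a ↦ (a, (B, 1ᵐ))`. [folklore] -/
theorem codeFP_ctx2 : CodeFP aE ctx2E (fun a => (a, (baseOf a, a.length))) :=
  (CodeFP.id aE).pair (codeFP_baseOf.pair (ulength natE))

/-- `a ↦ [0, …, m-1]`. [folklore] -/
theorem codeFP_range2 : CodeFP aE (rawE natE) (fun a => List.range a.length) :=
  urange.comp (ulength natE)

/-- On `((a, (B, 1ᵐ)), j)`: the exponent `1^{min (m - j) m}`. [folklore] -/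
theorem codeFP_expDown : CodeFP (pairE ctx2E natE) unE (fun t => min (t.1.2.2 - t.2) t.1.2.2) :=
  (unOfNatMin.comp ((CodeFP.fst _ _).snd'.snd'.pair (natSub.comp
    ((natOfUn.comp (CodeFP.fst _ _).snd'.snd').pair (CodeFP.snd _ _))))).congr fun _ => rfl

/-- On `((a, (B, 1ᵐ)), j)`: `B^{min (m-j) m}`. [folklore] -/
theorem codeFP_powDown : CodeFP (pairE ctx2E natE) natE (fun t => t.1.2.1 ^ (min (t.1.2.2 - t.2) t.1.2.2)) :=
  natPow.comp ((CodeFP.fst _ _).snd'.fst'.pair codeFP_expDown)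

/-- On `((a, (B, 1ᵐ)), j)`: `a_j B^{min (m-j) m}`. [folklore] -/
theorem codeFP_yTerm : CodeFP (pairE ctx2E natE) natE
    (fun t => t.1.1.getD t.2 0 * t.1.2.1 ^ (min (t.1.2.2 - t.2) t.1.2.2)) :=
  natMul.comp (((rawGetD natE (d := 0) rfl).comp ((CodeFP.fst _ _).fst'.pair (CodeFP.snd _ _))).pair
    codeFP_powDown)

/-- On `((a, (B, 1ᵐ)), j)`: the integer `B^{min (m-j) m}` in sign–magnitude. [folklore] -/
theorem codeFP_powDownZ : CodeFP (pairE ctx2E natE) smE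
    (fun t => ((t.1.2.1 ^ (min (t.1.2.2 - t.2) t.1.2.2) : ℕ) : ℤ)) :=
  (smOfInt.comp (intOfNat.comp codeFP_powDown)).congr fun _ => rfl

/-- On `((a, (B, 1ᵐ)), k)`: `B^{min k m}`. [folklore] -/
theorem codeFP_powUp : CodeFP (pairE ctx2E natE) natE (fun t => t.1.2.1 ^ (min t.2 t.1.2.2)) :=
  natPow.comp ((CodeFP.fst _ _).snd'.fst'.pair (unOfNatMin.comp ((CodeFP.fst _ _).snd'.snd'.pair
    (CodeFP.snd _ _))))

/-- `y` as a natural number: `Σ_{j<m} a_j B^{m-j}`. [folklore] -/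
def yNat (a : List ℕ) : ℕ := ((List.range a.length).map fun j => a.getD j 0 * baseOf a ^ (a.length - j)).sum

/-- `yNat` is the integer `y` of level 2. [folklore] -/
theorem cast_yNat (a : List ℕ) : (yNat a : ℤ) = yv a.length (fun j => a.getD j 0) (baseOf a) := by
  unfold yNat yv
  rw [sum_map_range]
  push_cast
  rfl

/-- `a ↦ y`. [folklore] -/
theorem codeFP_yNat : CodeFP aE natE yNat :=
  (natSum.comp ((CodeFP.map codeFP_yTerm).comp (codeFP_ctx2.pair codeFP_range2))).congr fun a => by
    unfold yNat
    congr 1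
    exact List.map_congr_left fun j _ => by rw [min_eq_left (Nat.sub_le _ _)]

/-- The numerators, computed: `2y` and the powers, as integers. [folklore] -/
def numList' (a : List ℕ) : List ℤ :=
  ((2 * yNat a : ℕ) : ℤ) :: (List.range a.length).map fun j => ((baseOf a ^ (a.length - j) : ℕ) : ℤ)

/-- The computed numerators are the numerators. [folklore] -/
theorem numList'_eq (a : List ℕ) : numList' a = numList a := by
  unfold numList' numList
  push_cast
  rw [cast_yNat]

/-- `a ↦ numList a` (raw list of sign–magnitude integers). [folklore] -/
theorem codeFP_numList : CodeFP aE (rawE smE) numList := by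
  have hhead : CodeFP aE smE (fun a => ((2 * yNat a : ℕ) : ℤ)) :=
    (smOfInt.comp (intOfNat.comp (natMul.comp ((CodeFP.const aE 2).pair codeFP_yNat)))).congr fun _ => rfl
  have htail : CodeFP aE (rawE smE)
      (fun a => (List.range a.length).map fun j => ((baseOf a ^ (a.length - j) : ℕ) : ℤ)) :=
    ((CodeFP.map codeFP_powDownZ).comp (codeFP_ctx2.pair codeFP_range2)).congr fun a =>
      List.map_congr_left fun j _ => by simp only [min_eq_left (Nat.sub_le _ _)]
  exact ((rawCons smE).comp (hhead.pair htail)).congr fun a => numList'_eq a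

/-- `a ↦ N = Σ_{k<m} B^k`. [folklore] -/
theorem codeFP_Nv : CodeFP aE natE (fun a => Nv a.length (baseOf a)) :=
  (natSum.comp ((CodeFP.map codeFP_powUp).comp (codeFP_ctx2.pair codeFP_range2))).congr fun a => by
    show ((List.range a.length).map fun k => baseOf a ^ min k a.length).sum = _
    rw [map_range_min_congr a.length (fun k => baseOf a ^ k), sum_map_range]
    rfl

/-- `a ↦ ε = 1/(B-1)`. [folklore] -/
theorem codeFP_eps : CodeFP aE encodeRat (fun a => 1 / ((baseOf a : ℚ) - 1)) :=
  (ratOfIntNat.comp ((CodeFP.const aE (1 : ℤ)).pair (natSub.comp (codeFP_baseOf.pair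
    (CodeFP.const aE 1))))).congr fun a => by
    have h : 1 ≤ baseOf a := le_trans (by norm_num) (four_le_baseOf a)
    show ((1 : ℤ) : ℚ) / ((baseOf a - 1 : ℕ) : ℚ) = 1 / ((baseOf a : ℚ) - 1)
    push_cast [Nat.cast_sub h]
    rfl

/-- The code of GSA instances split into its typed components. [folklore] -/
abbrev outE : (ℕ × List ℤ) × (ℕ × (ℕ × ℚ)) → List Bool :=
  pairE (pairE natE (listE smE)) (pairE natE (pairE natE encodeRat))

/-- The GSA instance data of level 2. [folklore] -/
def outData (a : List ℕ) : (ℕ × List ℤ) × (ℕ × (ℕ × ℚ)) :=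
  (((numList a).length, numList a), (baseOf a ^ (a.length + 1), (Nv a.length (baseOf a),
    1 / ((baseOf a : ℚ) - 1))))

/-- **`a ↦` the GSA instance data** in typed polynomial time. [cite: AroraBarak2009, §1.3] -/
theorem codeFP_outData : CodeFP aE outE outData :=
  (((natLength smE).comp codeFP_numList).pair ((listOfRaw smE).comp codeFP_numList)).pair
    ((natPow.comp (codeFP_baseOf.pair (unSucc.comp (ulength natE)))).pair (codeFP_Nv.pair codeFP_eps))

/-- **The whole reduction `w ↦` instance data of `gadget w`** in typed polynomial time.
[cite: AroraBarak2009, §1.3 (closure of polynomial time under composition and bounded loops)] -/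
theorem codeFP_reduction : CodeFP inE outE (fun w => outData (gadget w)) :=
  codeFP_outData.comp codeFP_gadget

/-- The code of the GSA instance is the typed code of its data. [folklore] -/
theorem encode_toInstance (a : List ℕ) :
    SimultaneousApproxInstance.encoding.encode (toInstance a) = outE (outData a) := by
  show boolPair (boolPair (encodeNat (numList a).length) ((encodingIntVecFin (numList a).length).encode
      (numList a).get)) (boolPair (encodeNat (baseOf a ^ (a.length + 1)))
        (boolPair (encodeNat (Nv a.length (baseOf a))) (encodeRat (1 / ((baseOf a : ℚ) - 1))))) = _
  have h : (encodingIntVecFin (numList a).length).encode (numList a).get = listE smE (numList a) := by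
    show encodingIntBool.listBool.encode (List.ofFn (numList a).get) = _
    rw [listE_eq, List.ofFn_get]
    rfl
  rw [h]
  rfl

/-- PARTITION codes are `inE` codes. [folklore] -/
theorem encode_partition_eq (w : List ℕ) : encodingListNatBool.encode w = inE w := by
  rw [show (encodingListNatBool.encode : List ℕ → List Bool) = listE natE from listE_eq encodingNatBool]

/-- **The transformation on genuine codes**: a polynomial-time string function taking the code
of `w` to the code of the GSA instance of `gadget w`. [cite: AroraBarak2009, §1.3] -/
theorem exists_fp_reduction : ∃ F ∈ FP, ∀ w : List ℕ,
    F (encodingListNatBool.encode w) = SimultaneousApproxInstance.encoding.encode (toInstance (gadget w)) := by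
  obtain ⟨F, hF, hFw⟩ := codeFP_reduction
  exact ⟨F, hF, fun w => by rw [encode_partition_eq, hFw, encode_toInstance]⟩

/-! ### `PARTITION ≤ₚ GSA` -/

/-- A fixed NO instance of GSA (bound `N = 0`). [folklore] -/
def badInstance : SimultaneousApproxInstance := (⟨0, fun i => i.elim0⟩, 1, 0, 0)

/-- The fixed instance is a NO instance. [folklore] -/
theorem not_yes_badInstance : ¬ badInstance.Yes := by
  rintro ⟨q, hq1, hq0, -⟩
  change q ≤ 0 at hq0
  omega

/-- The escape string: the code of the NO instance. [folklore] -/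
def badCode : List Bool := SimultaneousApproxInstance.encoding.encode badInstance

/-- The escape string is not in `GSA`. [folklore] -/
theorem badCode_not_mem : badCode ∉ gsaLang := fun h =>
  not_yes_badInstance ((encode_mem_gsaLang_iff badInstance).1 h)

/-- **The Karp reduction on all strings**: the transformation on PARTITION codes, the escape
elsewhere. [folklore] -/
noncomputable def redFn : List Bool → List Bool :=
  iteFn Knapsack.isCanonLFn (Classical.choose exists_fp_reduction) fun _ => badCode

/-- `redFn ∈ FP`. [cite: AroraBarak2009, §1.3] -/
theorem redFn_mem_FP : redFn ∈ FP :=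
  iteFn_mem_FP Knapsack.isCanonLFn_mem_FP (Classical.choose_spec exists_fp_reduction).1 (const_mem_FP _)

/-- Value of `redFn` on a PARTITION code. [folklore] -/
theorem redFn_encode (w : List ℕ) :
    redFn (encodingListNatBool.encode w) = SimultaneousApproxInstance.encoding.encode (toInstance (gadget w)) := by
  have hc : Knapsack.isCanonLFn (encodingListNatBool.encode w) = [true] := by
    rw [Knapsack.isCanonLFn_apply, Knapsack.decNatList_encode]; simp
  rw [redFn, iteFn_apply_true hc]
  exact (Classical.choose_spec exists_fp_reduction).2 w

/-- Value of `redFn` off the PARTITION codes. [folklore] -/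
theorem redFn_of_not_canon {x : List Bool} (hx : encodingListNatBool.encode (Knapsack.decNatList x) ≠ x) :
    redFn x = badCode := by
  have hc : Knapsack.isCanonLFn x = [false] := by rw [Knapsack.isCanonLFn_apply]; simp [hx]
  rw [redFn, iteFn_apply_false hc]

open scoped Literature.Computability.Complexity.Notation

/-- **`PARTITION ≤ₚ GSA`** (a Karp reduction in the tree's sense). Lagarias's printed transformation starts
from WEAK PARTITION; here it is precomposed with the PARTITION → weak-partition gadget of level 1, so that
the source is a problem the tree knows to be NP-complete.
[cite: Lagarias1985, main theorem (GSA is NP-complete; hardness)] -/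
theorem PARTITION_karpReducible_gsaLang : PARTITION ≤ₚ gsaLang := by
  refine ⟨redFn, redFn_mem_FP, fun x => ?_⟩
  by_cases hx : encodingListNatBool.encode (Knapsack.decNatList x) = x
  · rw [← hx, redFn_encode]
    exact ((encodingListNatBool.mem_toLanguage_iff partitionSet _).trans (partition_iff_yes _)).trans
      (encode_mem_gsaLang_iff _).symm
  · rw [redFn_of_not_canon hx]
    exact ⟨fun h => (hx (Knapsack.encode_decNatList_of_mem h)).elim, fun h => (badCode_not_mem h).elim⟩

/-- **GSA is NP-hard**: PARTITION is NP-complete in the tree and `PARTITION ≤ₚ GSA`.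
[cite: Lagarias1985, main theorem (GSA is NP-complete; hardness)] -/
theorem gsaLang_isNPHard : IsNPHard gsaLang :=
  IsHard.of_reducible_holds isNPComplete_PARTITION_holds.isHard PARTITION_karpReducible_gsaLang

end Machine


/-! ### `GSA ∈ NP`: the certificate is the denominator `q` in binary -/

section MemNP

open _root_.Computability Polynomial
open Literature.Computability.Complexity Literature.Computability.Complexity.CodeFP
open Brick NegCNF CanonCode Knapsack
open Literature.Algebra.EuclideanLattices (encodeRat encodingRatBool intVecEncoding encodingIntVecFin)

/-! Distance to the nearest integer of `X / b`, exactly -/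

/-- For `b > 0`: `‖X / b‖ = min(r, b - r) / b` with `r = X mod b`. [folklore] -/
theorem distNearestInt_intCast_div_natCast (X : ℤ) {b : ℕ} (hb : 0 < b) :
    distNearestInt ((X : ℚ) / b) = ((min (X % b) (b - X % b) : ℤ) : ℚ) / b := by
  set r := X % b with hr
  have hb' : (0 : ℚ) < b := by exact_mod_cast hb
  have hbz : (b : ℤ) ≠ 0 := by exact_mod_cast hb.ne'
  have hr0 : 0 ≤ r := Int.emod_nonneg _ hbz
  have hrb : r < b := Int.emod_lt_of_pos _ (by exact_mod_cast hb)
  have hX : (X : ℚ) / b = ((X / b : ℤ) : ℚ) + (r : ℚ) / b := by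
    have h : X = r + b * (X / b) := by rw [hr, Int.emod_def]; ring
    have h' : ((X : ℤ) : ℚ) = ((r + b * (X / b) : ℤ) : ℚ) := congrArg (fun z : ℤ => (z : ℚ)) h
    rw [h']
    push_cast
    field_simp
    ring
  rw [hX, distNearestInt_intCast_add]
  have hr0' : (0 : ℚ) ≤ r := by exact_mod_cast hr0
  have hrb' : (r : ℚ) < b := by exact_mod_cast hrb
  have hcast : (((min r ((b : ℤ) - r) : ℤ) : ℚ)) = min (r : ℚ) ((b : ℚ) - r) := by push_cast; rfl
  rw [hcast]
  apply le_antisymm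
  · rcases le_or_gt (r : ℚ) ((b : ℚ) - r) with h | h
    · rw [min_eq_left h]
      calc distNearestInt ((r : ℚ) / b) ≤ |(r : ℚ) / b - ((0 : ℤ) : ℚ)| := distNearestInt_le_abs_sub_intCast _ 0
        _ = (r : ℚ) / b := by rw [Int.cast_zero, sub_zero, abs_of_nonneg (by positivity)]
    · rw [min_eq_right h.le]
      calc distNearestInt ((r : ℚ) / b) ≤ |(r : ℚ) / b - ((1 : ℤ) : ℚ)| := distNearestInt_le_abs_sub_intCast _ 1
        _ = ((b : ℚ) - r) / b := by
            rw [Int.cast_one, abs_of_nonpos (by rw [sub_nonpos, div_le_one hb']; exact hrb'.le)]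
            field_simp
            ring
  · rw [distNearestInt_def]
    set p : ℤ := round ((r : ℚ) / b) with hp
    rcases le_or_gt p 0 with hp0 | hp1
    · have hp0' : ((p : ℤ) : ℚ) ≤ 0 := by exact_mod_cast hp0
      calc min (r : ℚ) ((b : ℚ) - r) / b ≤ (r : ℚ) / b :=
            div_le_div_of_nonneg_right (min_le_left _ _) hb'.le
        _ ≤ (r : ℚ) / b - p := by linarith
        _ ≤ |(r : ℚ) / b - p| := le_abs_self _
    · have hp1' : (1 : ℚ) ≤ ((p : ℤ) : ℚ) := by exact_mod_cast hp1
      have hle : (r : ℚ) / b ≤ 1 := by rw [div_le_one hb']; exact hrb'.le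
      calc min (r : ℚ) ((b : ℚ) - r) / b ≤ ((b : ℚ) - r) / b :=
            div_le_div_of_nonneg_right (min_le_right _ _) hb'.le
        _ = 1 - (r : ℚ) / b := by field_simp
        _ ≤ p - (r : ℚ) / b := by linarith
        _ ≤ |(r : ℚ) / b - p| := by rw [abs_sub_comm]; exact le_abs_self _

/-- The residue `q t - b ⌊q t / b⌋ = q t mod b`. [folklore] -/
def rres (q : ℕ) (t : ℤ) (b : ℕ) : ℤ := (q : ℤ) * t - (b : ℤ) * ((q : ℤ) * t / (b : ℤ))

/-- `rres` is the residue `q t mod b`. [folklore] -/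
theorem rres_eq (q : ℕ) (t : ℤ) (b : ℕ) : rres q t b = ((q : ℤ) * t) % (b : ℤ) := by
  rw [rres, Int.emod_def]

/-- **The integer test for `‖q t / b‖ ≤ ε`** (`b = 0`: the junk value `q t / 0 = 0`); the residue
`r = q t mod b` is `rres`. [folklore] -/
def distOK (q : ℕ) (t : ℤ) (b : ℕ) (ε : ℚ) : Bool :=
  if decide (b = 0) then decide (0 ≤ ε.num)
  else decide (rres q t b * ε.den ≤ ε.num * b) || decide (((b : ℤ) - rres q t b) * ε.den ≤ ε.num * b)

/-- Cross-multiplication: `z ≤ ε b ↔ z · den ε ≤ num ε · b`. [folklore] -/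
theorem intCast_le_mul_iff (z : ℤ) (ε : ℚ) (b : ℕ) :
    (z : ℚ) ≤ ε * b ↔ z * ε.den ≤ ε.num * b := by
  have hd : (0 : ℚ) < ε.den := by exact_mod_cast ε.den_pos
  conv_lhs => rw [← Rat.num_div_den ε, div_mul_eq_mul_div, le_div_iff₀ hd]
  norm_cast

/-- **Correctness of the integer test.** [folklore] -/
theorem distOK_iff (q : ℕ) (t : ℤ) (b : ℕ) (ε : ℚ) :
    distOK q t b ε = true ↔ distNearestInt ((q : ℚ) * (t : ℚ) / (b : ℚ)) ≤ ε := by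
  unfold distOK
  rcases Nat.eq_zero_or_pos b with hb | hb
  · subst hb
    simp [Rat.num_nonneg]
  · rw [if_neg (by simpa using hb.ne')]
    have hX : (q : ℚ) * (t : ℚ) / (b : ℚ) = (((q : ℤ) * t : ℤ) : ℚ) / b := by push_cast; rfl
    rw [hX, distNearestInt_intCast_div_natCast _ hb, ← rres_eq]
    have hb' : (0 : ℚ) < b := by exact_mod_cast hb
    rw [div_le_iff₀ hb', Bool.or_eq_true, decide_eq_true_eq, decide_eq_true_eq, ← intCast_le_mul_iff,
      ← intCast_le_mul_iff, ← min_le_iff]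
    push_cast
    exact Iff.rfl

/-! The typed data of an instance and the verifier's test -/

/-- The typed data `((d, entries), (b, (N, ε)))` of a GSA instance. [folklore] -/
def dataOf (I : SimultaneousApproxInstance) : (ℕ × List ℤ) × (ℕ × (ℕ × ℚ)) :=
  ((I.1.1, List.ofFn I.1.2), (I.2.1, (I.2.2.1, I.2.2.2)))

/-- The code of an instance is the typed code of its data. [folklore] -/
theorem encode_eq_outE_dataOf (I : SimultaneousApproxInstance) :
    SimultaneousApproxInstance.encoding.encode I = outE (dataOf I) := by
  obtain ⟨⟨d, v⟩, b, N, ε⟩ := I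
  show boolPair (boolPair (encodeNat d) ((encodingIntVecFin d).encode v))
      (boolPair (encodeNat b) (boolPair (encodeNat N) (encodeRat ε))) = _
  have h : (encodingIntVecFin d).encode v = listE smE (List.ofFn v) := by
    show encodingIntBool.listBool.encode (List.ofFn v) = _
    rw [listE_eq]
    rfl
  rw [h]
  rfl

/-- **The verifier's test** on `(data, certificate)`: `1 ≤ q ≤ N` and every coordinate passes the
integer test, `q` the number read off the certificate. [folklore] -/
def chk (v : ((ℕ × List ℤ) × (ℕ × (ℕ × ℚ))) × List Bool) : Bool :=
  decide (1 ≤ bitsToNat v.2) && (decide (bitsToNat v.2 ≤ v.1.2.2.1) &&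
    v.1.1.2.all fun t => distOK (bitsToNat v.2) t v.1.2.1 v.1.2.2.2)

/-- The GSA condition at a given denominator. [folklore] -/
def YesAt (I : SimultaneousApproxInstance) (q : ℕ) : Prop :=
  1 ≤ q ∧ q ≤ I.2.2.1 ∧ ∀ i : Fin I.1.1, distNearestInt ((q : ℚ) * I.1.2 i / I.2.1) ≤ I.2.2.2

/-- `Yes` is `YesAt` at some denominator. [folklore] -/
theorem yes_iff_exists_yesAt (I : SimultaneousApproxInstance) : I.Yes ↔ ∃ q, YesAt I q := Iff.rfl

/-- **The test decides `YesAt`.** [folklore] -/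
theorem chk_dataOf (I : SimultaneousApproxInstance) (y : List Bool) :
    chk (dataOf I, y) = true ↔ YesAt I (bitsToNat y) := by
  simp only [chk, dataOf, YesAt, Bool.and_eq_true, decide_eq_true_eq, List.all_eq_true,
    List.forall_mem_ofFn_iff, distOK_iff]

/-- The context of the coordinate test: `(q, (b, ε))`. [folklore] -/
abbrev tctxE : ℕ × (ℕ × ℚ) → List Bool := pairE natE (pairE natE encodeRat)

/-- The code of the coordinate test's arguments `((q, (b, ε)), t)`. [folklore] -/
abbrev uE : (ℕ × (ℕ × ℚ)) × ℤ → List Bool := pairE tctxE smE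

/-- On `((q, (b, ε)), t)`: the field `q`. [folklore] -/
theorem codeFP_u_q : CodeFP uE natE (fun u => u.1.1) := (CodeFP.fst _ _).fst'
/-- On `((q, (b, ε)), t)`: the field `b`. [folklore] -/
theorem codeFP_u_b : CodeFP uE natE (fun u => u.1.2.1) := (CodeFP.fst _ _).snd'.fst'
/-- On `((q, (b, ε)), t)`: `b` as an integer. [folklore] -/
theorem codeFP_u_bZ : CodeFP uE intE (fun u => (u.1.2.1 : ℤ)) := intOfNat.comp codeFP_u_b
/-- On `((q, (b, ε)), t)`: `(num ε, den ε)`. [folklore] -/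
theorem codeFP_u_nd : CodeFP uE (pairE intE natE) (fun u => (u.1.2.2.num, u.1.2.2.den)) :=
  ratNumDen.comp (CodeFP.fst _ _).snd'.snd'
/-- On `((q, (b, ε)), t)`: `num ε`. [folklore] -/
theorem codeFP_u_num : CodeFP uE intE (fun u => u.1.2.2.num) := codeFP_u_nd.fst'
/-- On `((q, (b, ε)), t)`: `den ε` as an integer. [folklore] -/
theorem codeFP_u_den : CodeFP uE intE (fun u => (u.1.2.2.den : ℤ)) := intOfNat.comp codeFP_u_nd.snd'
/-- On `((q, (b, ε)), t)`: the entry `t` as a difference pair. [folklore] -/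
theorem codeFP_u_t : CodeFP uE intE (fun u => u.2) := (intOfSM.comp (CodeFP.snd tctxE smE)).congr fun _ => rfl
/-- On `((q, (b, ε)), t)`: the product `q t`. [folklore] -/
theorem codeFP_u_X : CodeFP uE intE (fun u => (u.1.1 : ℤ) * u.2) :=
  (intMul.comp ((intOfNat.comp codeFP_u_q).pair codeFP_u_t)).congr fun _ => rfl

/-- The residue on codes. [folklore] -/
theorem codeFP_rres : CodeFP uE intE (fun u => rres u.1.1 u.2 u.1.2.1) :=
  (intSub.comp (codeFP_u_X.pair (intMul.comp (codeFP_u_bZ.pair (intEDiv.comp (codeFP_u_X.pair codeFP_u_bZ)))))).congr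
    fun _ => rfl

/-- **The coordinate test on codes.** [folklore] -/
theorem codeFP_distOK : CodeFP uE bitE (fun u => distOK u.1.1 u.2 u.1.2.1 u.1.2.2) := by
  have hrhs : CodeFP uE intE (fun u => u.1.2.2.num * (u.1.2.1 : ℤ)) :=
    (intMul.comp (codeFP_u_num.pair codeFP_u_bZ)).congr fun _ => rfl
  have hl1 : CodeFP uE intE (fun u => rres u.1.1 u.2 u.1.2.1 * u.1.2.2.den) :=
    (intMul.comp (codeFP_rres.pair codeFP_u_den)).congr fun _ => rfl
  have hc1 : CodeFP uE bitE (fun u => decide (rres u.1.1 u.2 u.1.2.1 * u.1.2.2.den ≤ u.1.2.2.num * (u.1.2.1 : ℤ))) :=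
    (intLe.comp (hl1.pair hrhs)).congr fun _ => rfl
  have hd2 : CodeFP uE intE (fun u => (u.1.2.1 : ℤ) - rres u.1.1 u.2 u.1.2.1) :=
    (intSub.comp (codeFP_u_bZ.pair codeFP_rres)).congr fun _ => rfl
  have hl2 : CodeFP uE intE (fun u => ((u.1.2.1 : ℤ) - rres u.1.1 u.2 u.1.2.1) * u.1.2.2.den) :=
    (intMul.comp (hd2.pair codeFP_u_den)).congr fun _ => rfl
  have hc2 : CodeFP uE bitE (fun u => decide (((u.1.2.1 : ℤ) - rres u.1.1 u.2 u.1.2.1) * u.1.2.2.den ≤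
      u.1.2.2.num * (u.1.2.1 : ℤ))) :=
    (intLe.comp (hl2.pair hrhs)).congr fun _ => rfl
  have hc0 : CodeFP uE bitE (fun u => decide (0 ≤ u.1.2.2.num)) :=
    (intLe.comp ((CodeFP.const uE (0 : ℤ)).pair codeFP_u_num)).congr fun _ => rfl
  have hz : CodeFP uE bitE (fun u => decide (u.1.2.1 = 0)) :=
    (natEq.comp (codeFP_u_b.pair (CodeFP.const uE 0))).congr fun _ => rfl
  exact (hz.ite hc0 (hc1.or hc2)).congr fun _ => rfl

/-- The code of verifier inputs `⟨instance data, certificate⟩`. [folklore] -/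
abbrev vE : ((ℕ × List ℤ) × (ℕ × (ℕ × ℚ))) × List Bool → List Bool := pairE outE strE

/-- **The verifier's test on codes.** [folklore] -/
theorem codeFP_chk : CodeFP vE bitE chk := by
  have hq : CodeFP vE natE (fun v => bitsToNat v.2) := (strVal.comp (CodeFP.snd _ _)).congr fun _ => rfl
  have hN : CodeFP vE natE (fun v => v.1.2.2.1) := (CodeFP.fst _ _).snd'.snd'.fst'
  have hb : CodeFP vE natE (fun v => v.1.2.1) := (CodeFP.fst _ _).snd'.fst'
  have hε : CodeFP vE encodeRat (fun v => v.1.2.2.2) := (CodeFP.fst _ _).snd'.snd'.snd'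
  have hL : CodeFP vE (rawE smE) (fun v => v.1.1.2) := ((rawOfList smE).comp (CodeFP.fst _ _).fst'.snd').congr
    fun _ => rfl
  have hall : CodeFP vE bitE (fun v => v.1.1.2.all fun t => distOK (bitsToNat v.2) t v.1.2.1 v.1.2.2.2) :=
    ((CodeFP.all codeFP_distOK).comp ((hq.pair (hb.pair hε)).pair hL)).congr fun _ => rfl
  have h1 : CodeFP vE bitE (fun v => decide (1 ≤ bitsToNat v.2)) :=
    (natLe.comp ((CodeFP.const vE 1).pair hq)).congr fun _ => rfl
  have h2 : CodeFP vE bitE (fun v => decide (bitsToNat v.2 ≤ v.1.2.2.1)) := (natLe.comp (hq.pair hN)).congr fun _ => rfl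
  exact (h1.and (h2.and hall)).congr fun _ => rfl

/-! Canonical codes: rationals, integer vectors, instances -/

/-- The rational read off any string by `encodingRatBool.decode` (total). [folklore] -/
def decRat (w : List Bool) : ℚ := (decInt (boolUnpair w).1 : ℚ) / (decodeNat (boolUnpair w).2 : ℚ)

/-- `encodingRatBool.decode` is total with value `decRat`. [folklore] -/
theorem decode_rat (w : List Bool) : encodingRatBool.decode w = some (decRat w) := by
  rw [show encodingRatBool.decode w = ((encodingIntBool.pairBool encodingNatBool).decode w).map
    (fun p => (p.1 : ℚ) / (p.2 : ℚ)) from rfl]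
  rw [(canonPairFn_eq encodingIntBool encodingNatBool decInt decodeNat decode_int decode_natBool
    canonIntFn_eq canonF_eq_encodeNat_decodeNat w).1]
  rfl

/-- The lowest-terms fraction of a pair `⟨sign–magnitude integer, numeral⟩`, in `FP`. [folklore] -/
theorem codeFP_ratOfSMNat : CodeFP (pairE smE natE) encodeRat (fun p => (p.1 : ℚ) / (p.2 : ℚ)) :=
  (ratOfIntNat.comp ((intOfSM.comp (CodeFP.fst _ _)).pair (CodeFP.snd _ _))).congr fun _ => rfl

/-- **Canonicalisation of rational codes**: canonicalise the two components, then normalise the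
fraction. [folklore] -/
noncomputable def canonRatFn : List Bool → List Bool :=
  Classical.choose codeFP_ratOfSMNat ∘ canonPairFn canonIntFn canonF

/-- `canonRatFn ∈ FP`. [cite: AroraBarak2009, §1.3] -/
theorem canonRatFn_mem_FP : canonRatFn ∈ FP :=
  comp_mem_FP (Classical.choose_spec codeFP_ratOfSMNat).1 (canonPairFn_mem_FP canonIntFn_mem_FP canonF_mem_FP)

/-- `canonRatFn = encode ∘ decRat`. [folklore] -/
theorem canonRatFn_eq (w : List Bool) : canonRatFn w = encodingRatBool.encode (decRat w) := by
  rw [canonRatFn, Function.comp_apply, canonPairFn_apply, canonIntFn_eq, canonF_eq_encodeNat_decodeNat]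
  exact (Classical.choose_spec codeFP_ratOfSMNat).2 (decInt (boolUnpair w).1, decodeNat (boolUnpair w).2)

/-- The scalar part `(b, (N, ε))` of an instance: its total decoder. [folklore] -/
def decScal (w : List Bool) : ℕ × (ℕ × ℚ) :=
  (decodeNat (boolUnpair w).1, (decodeNat (boolUnpair (boolUnpair w).2).1, decRat (boolUnpair (boolUnpair w).2).2))

/-- Canonicalisation of the scalar part. [folklore] -/
noncomputable def canonScalFn : List Bool → List Bool := canonPairFn canonF (canonPairFn canonF canonRatFn)

/-- `canonScalFn ∈ FP`. [cite: AroraBarak2009, §1.3] -/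
theorem canonScalFn_mem_FP : canonScalFn ∈ FP :=
  canonPairFn_mem_FP canonF_mem_FP (canonPairFn_mem_FP canonF_mem_FP canonRatFn_mem_FP)

/-- The scalar encoding. [folklore] -/
abbrev scalEnc : Encoding (ℕ × (ℕ × ℚ)) Bool := encodingNatBool.pairBool (encodingNatBool.pairBool encodingRatBool)

/-- `canonScalFn` re-encodes the (total) decoding of the scalar part. [folklore] -/
theorem canonScalFn_eq (w : List Bool) :
    scalEnc.decode w = some (decScal w) ∧ canonScalFn w = scalEnc.encode (decScal w) := by
  have hin := fun u => canonPairFn_eq encodingNatBool encodingRatBool decodeNat decRat decode_natBool decode_rat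
    canonF_eq_encodeNat_decodeNat canonRatFn_eq u
  exact canonPairFn_eq encodingNatBool (encodingNatBool.pairBool encodingRatBool) decodeNat
    (fun u => (decodeNat (boolUnpair u).1, decRat (boolUnpair u).2)) decode_natBool (fun u => (hin u).1)
    canonF_eq_encodeNat_decodeNat (fun u => (hin u).2) w

/-- The integer list read off the vector part of a string. [folklore] -/
def decEntries (u : List Bool) : List ℤ :=
  decList decInt (boolUnpair (boolUnpair u).2).1.length (boolUnpair (boolUnpair u).2).2

/-- **Canonicalisation of integer-vector codes** (`sigmaBool encodingIntVecFin`): the dimension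
header is recomputed from the unary length of the entry list, the entries are canonicalised.
[folklore] -/
noncomputable def canonIVFn : List Bool → List Bool :=
  fanoutFn (lenBinF ∘ fstF ∘ sndF) (canonListFn canonIntFn ∘ sndF)

/-- `canonIVFn ∈ FP`. [cite: AroraBarak2009, §1.3] -/
theorem canonIVFn_mem_FP : canonIVFn ∈ FP :=
  fanoutFn_mem_FP (comp_mem_FP lenBinF_mem_FP (comp_mem_FP fstF_mem_FP sndF_mem_FP))
    (comp_mem_FP (canonListFn_mem_FP canonIntFn_mem_FP length_canonIntFn_le) sndF_mem_FP)

/-- The code of the vector `⟨|L|, L⟩`. [folklore] -/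
theorem intVecEncoding_encode_list (L : List ℤ) :
    intVecEncoding.encode ⟨L.length, L.get⟩ = boolPair (encodeNat L.length) (encodingIntBool.listBool.encode L) := by
  show boolPair (encodeNat L.length) (encodingIntBool.listBool.encode (List.ofFn L.get)) = _
  rw [List.ofFn_get]

/-- **`canonIVFn u` is the code of the vector `⟨|entries|, entries⟩`.** [folklore] -/
theorem canonIVFn_eq (u : List Bool) :
    canonIVFn u = intVecEncoding.encode ⟨(decEntries u).length, (decEntries u).get⟩ := by
  have h := (canonListFn_eq encodingIntBool decInt decode_int canonIntFn_eq (sndF u)).2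
  rw [intVecEncoding_encode_list, canonIVFn, fanoutFn_apply, Function.comp_apply, Function.comp_apply,
    Function.comp_apply, h, lenBinF_apply, decEntries, length_decList]
  rfl

/-- On genuine vector codes `canonIVFn` is the identity. [folklore] -/
theorem canonIVFn_encode (p : Σ n, Fin n → ℤ) : canonIVFn (intVecEncoding.encode p) = intVecEncoding.encode p := by
  obtain ⟨d, v⟩ := p
  have hu : intVecEncoding.encode ⟨d, v⟩ = boolPair (encodeNat d) (encodingIntBool.listBool.encode (List.ofFn v)) := rfl
  have hdec := (canonListFn_eq encodingIntBool decInt decode_int canonIntFn_eq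
    (encodingIntBool.listBool.encode (List.ofFn v))).1
  rw [encodingIntBool.listBool.decode_encode] at hdec
  have hL : decEntries (intVecEncoding.encode ⟨d, v⟩) = List.ofFn v := by
    rw [decEntries, hu, boolUnpair_boolPair]
    exact (Option.some.inj hdec).symm
  rw [canonIVFn_eq, intVecEncoding_encode_list, hL, List.length_ofFn, hu]

/-- The instance read off any string. [folklore] -/
def decInstance (x : List Bool) : SimultaneousApproxInstance :=
  (⟨(decEntries (boolUnpair x).1).length, (decEntries (boolUnpair x).1).get⟩, decScal (boolUnpair x).2)

/-- **Canonicalisation of GSA codes.** [folklore] -/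
noncomputable def canonGFn : List Bool → List Bool := fanoutFn (canonIVFn ∘ fstF) (canonScalFn ∘ sndF)

/-- `canonGFn ∈ FP`. [cite: AroraBarak2009, §1.3] -/
theorem canonGFn_mem_FP : canonGFn ∈ FP :=
  fanoutFn_mem_FP (comp_mem_FP canonIVFn_mem_FP fstF_mem_FP) (comp_mem_FP canonScalFn_mem_FP sndF_mem_FP)

/-- `canonGFn x` is the code of `decInstance x`. [folklore] -/
theorem canonGFn_eq (x : List Bool) : canonGFn x = SimultaneousApproxInstance.encoding.encode (decInstance x) := by
  rw [canonGFn, fanoutFn_apply, Function.comp_apply, Function.comp_apply, canonIVFn_eq, (canonScalFn_eq _).2]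
  rfl

/-- **A string is a GSA code iff canonicalisation fixes it.** [folklore] -/
theorem canonGFn_eq_self_iff (x : List Bool) :
    canonGFn x = x ↔ ∃ I : SimultaneousApproxInstance, SimultaneousApproxInstance.encoding.encode I = x := by
  constructor
  · intro h
    exact ⟨decInstance x, by rw [← canonGFn_eq, h]⟩
  · rintro ⟨⟨p, s⟩, rfl⟩
    have hx : SimultaneousApproxInstance.encoding.encode (p, s) = boolPair (intVecEncoding.encode p) (scalEnc.encode s) := rfl
    have hs : decScal (scalEnc.encode s) = s := by
      have h1 := (canonScalFn_eq (scalEnc.encode s)).1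
      rw [scalEnc.decode_encode] at h1
      exact (Option.some.inj h1).symm
    rw [canonGFn, fanoutFn_apply, Function.comp_apply, Function.comp_apply, hx, fstF_boolPair, sndF_boolPair,
      canonIVFn_encode, (canonScalFn_eq _).2, hs]

/-- The code test `[canonGFn x = x]`. [folklore] -/
noncomputable def isCanonGFn : List Bool → List Bool := eqPairFn ∘ fanoutFn canonGFn id

/-- `isCanonGFn ∈ FP`. [cite: AroraBarak2009, §1.3] -/
theorem isCanonGFn_mem_FP : isCanonGFn ∈ FP :=
  comp_mem_FP eqPairFn_mem_FP (fanoutFn_mem_FP canonGFn_mem_FP (PolyTimeComputable.id _))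

/-- Value of the code test. [folklore] -/
theorem isCanonGFn_apply (x : List Bool) : isCanonGFn x = [decide (canonGFn x = x)] := by
  rw [isCanonGFn, Function.comp_apply, fanoutFn_apply, eqPairFn_boolPair]; rfl

/-! The verifier -/

/-- **The GSA verifier**: on `⟨x, y⟩`, if `x` is a GSA code run the test, else reject; the output
is normalised to one bit. [folklore] -/
noncomputable def verFn : List Bool → List Bool :=
  eqPairFn ∘ fanoutFn (iteFn (isCanonGFn ∘ fstF) (Classical.choose codeFP_chk) fun _ => [false]) fun _ => [true]

/-- **The verifier is polynomial time.** [cite: AroraBarak2009, §1.3] -/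
theorem verFn_mem_FP : verFn ∈ FP :=
  comp_mem_FP eqPairFn_mem_FP (fanoutFn_mem_FP (iteFn_mem_FP (comp_mem_FP isCanonGFn_mem_FP fstF_mem_FP)
    (Classical.choose_spec codeFP_chk).1 (const_mem_FP _)) (const_mem_FP _))

/-- The verifier is one-bit. [folklore] -/
theorem oneBit_verFn : OneBit verFn := oneBit_eqPairFn.comp _

/-- **Value of the verifier on a genuine instance code.** [folklore] -/
theorem verFn_encode (I : SimultaneousApproxInstance) (y : List Bool) :
    verFn (boolPair (SimultaneousApproxInstance.encoding.encode I) y) = [chk (dataOf I, y)] := by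
  have hc : (isCanonGFn ∘ fstF) (boolPair (SimultaneousApproxInstance.encoding.encode I) y) = [true] := by
    rw [Function.comp_apply, fstF_boolPair, isCanonGFn_apply]
    simp [(canonGFn_eq_self_iff _).2 ⟨I, rfl⟩]
  have hF : Classical.choose codeFP_chk (boolPair (SimultaneousApproxInstance.encoding.encode I) y) =
      [chk (dataOf I, y)] := by
    rw [encode_eq_outE_dataOf]
    exact (Classical.choose_spec codeFP_chk).2 (dataOf I, y)
  rw [verFn, Function.comp_apply, fanoutFn_apply, iteFn_apply_true hc, hF, eqPairFn_boolPair]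
  cases chk (dataOf I, y) <;> rfl

/-- Value of the verifier off the instance codes. [folklore] -/
theorem verFn_of_not_code {x : List Bool} (hx : ¬ ∃ I, SimultaneousApproxInstance.encoding.encode I = x)
    (y : List Bool) : verFn (boolPair x y) = [false] := by
  have hc : (isCanonGFn ∘ fstF) (boolPair x y) = [false] := by
    rw [Function.comp_apply, fstF_boolPair, isCanonGFn_apply]
    simp [(canonGFn_eq_self_iff x).not.2 hx]
  rw [verFn, Function.comp_apply, fanoutFn_apply, iteFn_apply_false hc, eqPairFn_boolPair]
  rfl

/-- The verifier's language. [folklore] -/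
def verLang : Language Bool := {z | verFn z = [true]}

/-- **The verifier's language is in `P`.** [folklore] -/
theorem verLang_mem_P : verLang ∈ Classes.P :=
  mem_P_of_mem_FP verFn_mem_FP _ fun w => ⟨id, fun hw => by
    obtain ⟨b, hb⟩ := oneBit_verFn w
    cases b
    · exact hb
    · exact absurd hb hw⟩

/-- The certificate `bin q` of a YES instance is no longer than the instance code. [folklore] -/
theorem length_natE_le_length_encode (I : SimultaneousApproxInstance) {q : ℕ} (hq : q ≤ I.2.2.1) :
    (natE q).length ≤ (SimultaneousApproxInstance.encoding.encode I).length := by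
  have h1 : (natE q).length ≤ (natE I.2.2.1).length := by
    rw [length_natE, length_natE]; exact Nat.size_le_size hq
  have h2 : (natE I.2.2.1).length ≤ (SimultaneousApproxInstance.encoding.encode I).length := by
    rw [encode_eq_outE_dataOf]
    simp only [outE, dataOf, pairE_apply, length_boolPair]
    omega
  exact h1.trans h2

/-- **GSA ∈ NP** (the easy half of Lagarias's theorem): the certificate of a YES instance is its
denominator `q ≤ N` in binary, no longer than the instance code; the verifier's language `verLang ∈ P`
accepts `⟨x, y⟩` iff `x` codes an instance satisfied at `q = val y`.
[cite: Lagarias1985, main theorem (GSA is NP-complete; membership)] -/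
theorem gsaLang_mem_NP : gsaLang ∈ Nondeterministic.NP := by
  refine ⟨verLang, verLang_mem_P, X, fun x => ?_⟩
  constructor
  · rintro ⟨I, hI, rfl⟩
    obtain ⟨q, hq⟩ := hI
    refine ⟨natE q, ?_, ?_⟩
    · rw [eval_X]; exact length_natE_le_length_encode I hq.2.1
    · show verFn _ = [true]
      rw [verFn_encode, (chk_dataOf I (natE q)).2 (by rw [bitsToNat_natE]; exact hq)]
  · rintro ⟨y, -, hy⟩
    change verFn (boolPair x y) = [true] at hy
    by_cases hx : ∃ I, SimultaneousApproxInstance.encoding.encode I = x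
    · obtain ⟨I, rfl⟩ := hx
      rw [verFn_encode] at hy
      have hyes : I.Yes := ⟨bitsToNat y, (chk_dataOf I y).1 (by simpa using hy)⟩
      exact ⟨I, hyes, rfl⟩
    · rw [verFn_of_not_code hx] at hy
      exact absurd hy (by simp)

end MemNP

/-- **Lagarias 1985: GOOD SIMULTANEOUS APPROXIMATION is NP-complete** — membership by the binary
certificate `q` (`gsaLang_mem_NP`), hardness by `PARTITION ≤ₚ GSA` (`gsaLang_isNPHard`).
[cite: Lagarias1985, main theorem (GSA is NP-complete)] -/
theorem gsa_isNPComplete : Literature.Computability.Complexity.IsNPComplete gsaLang :=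
  ⟨gsaLang_mem_NP, gsaLang_isNPHard⟩

end Lagarias

/-- **Discharge of `Lagarias1985_gsa_isNPComplete`.**
[cite: Lagarias1985, main theorem (GSA is NP-complete)] -/
theorem Lagarias1985_gsa_isNPComplete_holds : Lagarias1985_gsa_isNPComplete := Lagarias.gsa_isNPComplete


end Literature.NumberTheory.DiophantineApproximation
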